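import Literature.Analysis.Complex.AnalyticCover
import Literature.Geometry.Kaehler.AnalyticSetChart
import Literature.Geometry.Kaehler.AnalyticSetComponents
import HarnessLib

/-!
# Closures of unions of components of the regular locus are analytic (Chirka §5.1 Thm. (2))

Discharge of the named fact
`Literature.Geometry.Kaehler.IsAnalyticSet.isAnalyticSet_closure_biUnion_connectedComponentIn`
(`Literature/Geometry/Kaehler/AnalyticSetComponents.lean`, [Chirka1989, §5.1 Thm. (2)]) and
hence, by the reductions already in the tree, of
`Literature.Geometry.Kaehler.IsAnalyticSet.hasPureCodim_closure_regularLocusOfCodim` ([Chirka1989, §5.2 Thm. 1]) and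
`Literature.Geometry.Kaehler.IsIrreducibleAnalyticSet.exists_hasPureCodim` ([Chirka1989, §5.3]: irreducible analytic
sets have pure codimension):
`Literature.Geometry.Kaehler.IsAnalyticSet.isAnalyticSet_closure_biUnion_connectedComponentIn_holds`,
`Literature.Geometry.Kaehler.IsAnalyticSet.hasPureCodim_closure_regularLocusOfCodim_holds`,
`Literature.Geometry.Kaehler.IsIrreducibleAnalyticSet.exists_hasPureCodim_holds`.

## The model-space theorem (`namespace Literature.SCV`)

Everything up to the last section happens in a finite-dimensional complex normed space `E`,
with the model-space predicates `IsZeroSetAt` (from `AnalyticCover.lean`), `IsRegPt`,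
`regLocus` (bridged to the manifold-level ones by `isRegularPointOfCodim_iff_isRegPt`,
`regularLocus_eq_regLocus`).

* **Good neighbourhoods** of regular points (`IsRegPt.exists_goodNhd`, `GoodNhd`): by the
  holomorphic implicit function theorem (`exists_straightening`) the set is, near a regular
  point, the holomorphic image of a ball; hence the regular locus is locally connected at its
  points, connected components of it are relatively open, and the identity theorem and the
  connectedness of complements of zero loci hold along it (`GoodNhd.subset_closure_ne_zero`,
  `GoodNhd.isPreconnected_inter_ne_zero`, `connectedComponentIn_subset_closure_ne_zero`).
* **The closure problem** `RegData W Z S`: `Z` analytic in the open set `W`, `S ⊆ regLocus Z`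
  relatively open and closed (equivalently a union of components, `RegData.of_biUnion`,
  `RegData.connectedComponentIn_subset`); it restricts to open subsets and is transported by
  linear isomorphisms. `IdimLE Z d`: through every point of `Z` passes an affine subspace of
  codimension `≤ d` meeting `Z` in an isolated point (the induction parameter; Chirka §3.5).
* **The induction** `isZeroSetAt_closure_of_idimLE` on `d` (Chirka's induction on `dim A`):
  the base `d = 0` is the discrete case; in the step, after the easy cases and a choice of
  adapted coordinates `E ≃ K × ℂ^{m+1}` (`exists_line_isolated`, `exists_equiv_adapted`), the
  point has isolated fibre and `AnalyticCover.lean` provides the local analytic cover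
  (`exists_coverSetup`, `CoverSetup.exists_cover_structure`); the step itself is
  `CoverSetup.isZeroSetAt_closure_core`: components meeting the unramified part `{Δ ≠ 0}` have
  analytic closure by `CoverPiece.closure_inter_eq`, the others lie in `Z ∩ {Δ = 0}`, whose
  intersection dimension is smaller (`CoverSetup.idimLE_inter_disc_zero`), and are recovered
  from components of its regular locus off the analytic set `cl (Z ∩ {Δ ≠ 0})`.
  The result is `RegData.isZeroSetAt_closure`.

## Transfer to manifolds (`namespace Literature`)

Extended charts transport analyticity and regularity
(`Literature/Geometry/Kaehler/AnalyticSetChart.lean`: `isAnalyticSetAt_iff_inExtChart`,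
`isRegularPointOfCodim_iff_inExtChart`, `extChartAt_target_inter_preimage_regularLocus`; restated
here in model-space language as `IsAnalyticSetAt.isZeroSetAt_chartImage`,
`isAnalyticSetAt_of_isZeroSetAt_chartImage`, `IsRegularPointOfCodim.isRegPt_chartImage`,
`isRegularPointOfCodim_of_isRegPt_chartImage`, `mem_regLocus_chartImage_iff`), the regular locus
of an analytic subset of a complex manifold is locally connected at its points
(`exists_nhds_preconnected_of_mem_regularLocus`), so unions of its components are relatively
clopen (`SCV.exists_nhds_inter_subset_biUnion_connectedComponentIn`,
`SCV.mem_biUnion_connectedComponentIn_of_mem_closure`), and the model-space theorem applies in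
a chart.

Differences from the printed proof: Chirka inducts on `dim A` and uses the local
parametrization theorem §3.7 with an *analytic* critical set `σ` and the dimension theory of
§3; here the induction is on the intersection dimension `IdimLE` and the critical set is only
located inside the zero set of a holomorphic `Δ ≢ 0` (which suffices, the Riemann extension
theorem being available across such sets); no Hausdorff measure, dimension theory or
irreducible decomposition is used.

## References

* E. M. Chirka, *Complex Analytic Sets*, Kluwer (1989), Ch. 1 §2.3 (regular points), §3.5
  Prop. 1, §3.7 Thm., §4.3 Thm., §5.1 Theorem (p. 52–53), §5.2 Thm. 1 (p. 53), §5.3 (p. 54)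
  [Chirka1989].
-/

open Complex Metric Set Filter Function
open scoped Topology Real

namespace Literature.Geometry.Kaehler
namespace SCV

/-! ## Regular points and good neighbourhoods in the model space -/

section ModelRegular

open scoped Manifold

variable {E : Type*} [NormedAddCommGroup E] [NormedSpace ℂ E]

/-- `IsRegPt Z p x`: model-space form of `Literature.Geometry.Kaehler.IsRegularPointOfCodim`: near `x` the set `Z ⊆ E` is
cut out by `p` holomorphic functions with surjective differential at `x`.
[Chirka, *Complex Analytic Sets*, §2.3] [folklore] -/
def IsRegPt (Z : Set E) (p : ℕ) (x : E) : Prop :=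
  ∃ U : Set E, IsOpen U ∧ x ∈ U ∧ ∃ g : E → (Fin p → ℂ), DifferentiableOn ℂ g U ∧
    Z ∩ U = U ∩ g ⁻¹' {0} ∧ Function.Surjective (fderiv ℂ g x)

/-- The model-space regular locus `{x ∈ Z | ∃ p, IsRegPt Z p x}`.
[Chirka, *Complex Analytic Sets*, §2.3] [folklore] -/
def regLocus (Z : Set E) : Set E :=
  {x ∈ Z | ∃ p, IsRegPt Z p x}

omit [NormedSpace ℂ E] in
/-- The regular locus is contained in the set. [folklore] -/
theorem regLocus_subset [NormedSpace ℂ E] (Z : Set E) : regLocus Z ⊆ Z := fun _ hx => hx.1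

/-- **Bridge**: `Literature.IsRegularPointOfCodim 𝓘(ℂ, E) Z p x ↔ IsRegPt Z p x`. [folklore] -/
theorem isRegularPointOfCodim_iff_isRegPt {Z : Set E} {p : ℕ} {x : E} :
    IsRegularPointOfCodim 𝓘(ℂ, E) Z p x ↔ IsRegPt Z p x := by
  simp only [IsRegularPointOfCodim, IsRegPt, mdifferentiableOn_iff_differentiableOn, mfderiv_eq_fderiv]
  rfl

/-- **Bridge**: `Literature.regularLocus 𝓘(ℂ, E) Z = regLocus Z`. [folklore] -/
theorem regularLocus_eq_regLocus (Z : Set E) : regularLocus 𝓘(ℂ, E) Z = regLocus Z := by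
  ext x
  simp only [regularLocus, regLocus, Set.mem_setOf_eq, isRegularPointOfCodim_iff_isRegPt]

/-- Locality of `IsZeroSetAt`: only the germ of `Z` at `x` matters. [folklore] -/
theorem isZeroSetAt_congr {Z Z' : Set E} {x : E} {V : Set E} (hV : IsOpen V) (hx : x ∈ V)
    (hZZ' : Z ∩ V = Z' ∩ V) : Literature.Analysis.Complex.SCV.IsZeroSetAt Z x ↔ Literature.Analysis.Complex.SCV.IsZeroSetAt Z' x :=
  ⟨fun h => h.congr hV hx hZZ', fun h => h.congr hV hx hZZ'.symm⟩

/-- Locality of `IsRegPt`. [folklore] -/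
theorem IsRegPt.congr {Z Z' : Set E} {p : ℕ} {x : E} (h : IsRegPt Z p x) {V : Set E}
    (hV : IsOpen V) (hx : x ∈ V) (hZZ' : Z ∩ V = Z' ∩ V) : IsRegPt Z' p x := by
  obtain ⟨U, hU, hxU, g, hg, hZU, hsurj⟩ := h
  refine ⟨U ∩ V, hU.inter hV, ⟨hxU, hx⟩, g, hg.mono Set.inter_subset_left, ?_, hsurj⟩
  calc Z' ∩ (U ∩ V) = (Z' ∩ V) ∩ U := by ac_rfl
    _ = (Z ∩ U) ∩ V := by rw [← hZZ']; ac_rfl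
    _ = (U ∩ g ⁻¹' {0}) ∩ V := by rw [hZU]
    _ = U ∩ V ∩ g ⁻¹' {0} := by ac_rfl

/-- Union of two sets cut out near `x` (products of the equations; via the manifold-level lemma
`Literature.Geometry.Kaehler.IsAnalyticSetAt.union`). [folklore] -/
theorem _root_.Literature.Analysis.Complex.SCV.IsZeroSetAt.union {Z Z' : Set E} {x : E} (hZ : Literature.Analysis.Complex.SCV.IsZeroSetAt Z x) (hZ' : Literature.Analysis.Complex.SCV.IsZeroSetAt Z' x) :
    Literature.Analysis.Complex.SCV.IsZeroSetAt (Z ∪ Z') x :=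
  Literature.Analysis.Complex.SCV.isZeroSetAt_iff_isAnalyticSetAt.2 ((Literature.Analysis.Complex.SCV.isZeroSetAt_iff_isAnalyticSetAt.1 hZ).union
    (Literature.Analysis.Complex.SCV.isZeroSetAt_iff_isAnalyticSetAt.1 hZ'))

/-- Intersection of two sets cut out near `x`. [folklore] -/
theorem _root_.Literature.Analysis.Complex.SCV.IsZeroSetAt.inter {Z Z' : Set E} {x : E} (hZ : Literature.Analysis.Complex.SCV.IsZeroSetAt Z x) (hZ' : Literature.Analysis.Complex.SCV.IsZeroSetAt Z' x) :
    Literature.Analysis.Complex.SCV.IsZeroSetAt (Z ∩ Z') x :=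
  Literature.Analysis.Complex.SCV.isZeroSetAt_iff_isAnalyticSetAt.2 ((Literature.Analysis.Complex.SCV.isZeroSetAt_iff_isAnalyticSetAt.1 hZ).inter
    (Literature.Analysis.Complex.SCV.isZeroSetAt_iff_isAnalyticSetAt.1 hZ'))

/-- A set which does not accumulate at `x` is cut out near `x` (by the equation `1 = 0`).
[folklore] -/
theorem _root_.Literature.Analysis.Complex.SCV.IsZeroSetAt.of_notMem_closure {Z : Set E} {x : E} (hx : x ∉ closure Z) : Literature.Analysis.Complex.SCV.IsZeroSetAt Z x :=
  Literature.Analysis.Complex.SCV.isZeroSetAt_iff_isAnalyticSetAt.2 (IsAnalyticSetAt.of_notMem_closure hx)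

/-- A set which is a neighbourhood of `x` is cut out near `x` (by no equation). [folklore] -/
theorem _root_.Literature.Analysis.Complex.SCV.IsZeroSetAt.of_mem_nhds {Z : Set E} {x : E} (hx : Z ∈ 𝓝 x) : Literature.Analysis.Complex.SCV.IsZeroSetAt Z x := by
  obtain ⟨U, hUZ, hU, hxU⟩ := _root_.mem_nhds_iff.1 hx
  refine ⟨U, hU, hxU, 0, fun _ => 0, differentiableOn_const _, ?_⟩
  ext y
  simp only [Set.mem_inter_iff, Set.mem_preimage, Set.mem_singleton_iff, and_true]
  exact ⟨fun h => h.2, fun h => ⟨hUZ h, h⟩⟩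

/-! ### Good neighbourhoods of regular points -/

/-- **Good neighbourhood data** at regular points: `N` is open, all points of `Z ∩ N` are
regular of codimension `p`, and `Z ∩ N` is the image of the ball `ball 0 ρ` of the complex normed
space `K` under the map `Ψ₀`, holomorphic on that ball. [folklore] -/
structure GoodNhd (Z N : Set E) (p : ℕ) {K : Type*} [NormedAddCommGroup K] [NormedSpace ℂ K]
    (ρ : ℝ) (Ψ₀ : K → E) : Prop where
  isOpen : IsOpen N
  regPt : ∀ y ∈ Z ∩ N, IsRegPt Z p y
  pos : 0 < ρ
  differentiableOn : DifferentiableOn ℂ Ψ₀ (ball 0 ρ)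
  image_eq : Ψ₀ '' ball 0 ρ = Z ∩ N

namespace GoodNhd

variable {Z N : Set E} {p : ℕ} {K : Type*} [NormedAddCommGroup K] [NormedSpace ℂ K] {ρ : ℝ}
  {Ψ₀ : K → E}

/-- The trace `Z ∩ N` of a good neighbourhood is preconnected. [folklore] -/
theorem isPreconnected (h : GoodNhd Z N p ρ Ψ₀) : IsPreconnected (Z ∩ N) := by
  rw [← h.image_eq]
  exact (convex_ball _ _).isPreconnected.image _ h.differentiableOn.continuousOn

/-- The trace of a good neighbourhood lies in the regular locus. [folklore] -/
theorem subset_regLocus (h : GoodNhd Z N p ρ Ψ₀) : Z ∩ N ⊆ regLocus Z :=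
  fun y hy => ⟨hy.1, p, h.regPt y hy⟩

/-- **Identity theorem on the trace of a good neighbourhood**: a holomorphic function (on an
open set containing `Z ∩ N`) which is non-zero at one point of `Z ∩ N` is non-zero on a dense
subset of `Z ∩ N`. [folklore] -/
theorem subset_closure_ne_zero {F' : Type*} [NormedAddCommGroup F'] [NormedSpace ℂ F']
    [CompleteSpace F'] (h : GoodNhd Z N p ρ Ψ₀) {φ : E → F'} {O : Set E} (hNO : Z ∩ N ⊆ O) (hφ : DifferentiableOn ℂ φ O) (hy₀ : ∃ y₀ ∈ Z ∩ N, φ y₀ ≠ 0) :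
    Z ∩ N ⊆ closure ((Z ∩ N) ∩ {y | φ y ≠ 0}) := by
  obtain ⟨y₀, hy₀, hφy₀⟩ := hy₀
  -- pull back to the ball in `K`
  have hcomp : DifferentiableOn ℂ (φ ∘ Ψ₀) (ball 0 ρ) :=
    hφ.comp h.differentiableOn fun k hk => hNO (h.image_eq ▸ Set.mem_image_of_mem Ψ₀ hk)
  obtain ⟨k₀, hk₀, rfl⟩ : y₀ ∈ Ψ₀ '' ball 0 ρ := h.image_eq ▸ hy₀
  intro y hy
  obtain ⟨k, hk, rfl⟩ : y ∈ Ψ₀ '' ball 0 ρ := h.image_eq ▸ hy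
  by_contra hcl
  -- near `Ψ₀ k`, `φ` vanishes on `Z ∩ N`; hence `φ ∘ Ψ₀` vanishes near `k`
  obtain ⟨V, hV, hVo, hkV⟩ : ∃ V : Set E, V ∩ ((Z ∩ N) ∩ {y | φ y ≠ 0}) = ∅ ∧ IsOpen V ∧
      Ψ₀ k ∈ V := by
    have := hcl
    rw [_root_.mem_closure_iff] at this
    push Not at this
    obtain ⟨V, hVo, hkV, hV⟩ := this
    exact ⟨V, hV, hVo, hkV⟩
  have hev : (φ ∘ Ψ₀) =ᶠ[𝓝 k] 0 := by
    have h1 : ∀ᶠ k' in 𝓝 k, k' ∈ ball (0 : K) ρ ∧ Ψ₀ k' ∈ V := by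
      refine Filter.Eventually.and (isOpen_ball.mem_nhds hk) ?_
      exact (h.differentiableOn.continuousOn.continuousAt (isOpen_ball.mem_nhds hk)).preimage_mem_nhds
        (hVo.mem_nhds hkV)
    refine h1.mono fun k' hk' => ?_
    by_contra hne
    have hmem : Ψ₀ k' ∈ V ∩ ((Z ∩ N) ∩ {y | φ y ≠ 0}) :=
      ⟨hk'.2, h.image_eq ▸ Set.mem_image_of_mem Ψ₀ hk'.1, hne⟩
    rw [hV] at hmem
    exact hmem
  have hzero := Literature.Analysis.Complex.SCV.eqOn_zero_of_preconnected_of_eventuallyEq_zero hcomp isOpen_ball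
    (convex_ball _ _).isPreconnected hk hev hk₀
  exact hφy₀ hzero

/-- **Complements of zero loci in the trace of a good neighbourhood are preconnected.**
[folklore] -/
theorem isPreconnected_inter_ne_zero (h : GoodNhd Z N p ρ Ψ₀) {m : ℕ} {Φ : E → Fin m → ℂ}
    {O : Set E} (hNO : Z ∩ N ⊆ O) (hΦ : DifferentiableOn ℂ Φ O) :
    IsPreconnected ((Z ∩ N) ∩ {y | Φ y ≠ 0}) := by
  have hcomp : DifferentiableOn ℂ (Φ ∘ Ψ₀) (ball 0 ρ) :=
    hΦ.comp h.differentiableOn fun k hk => hNO (h.image_eq ▸ Set.mem_image_of_mem Ψ₀ hk)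
  have heq : (Z ∩ N) ∩ {y | Φ y ≠ 0} = Ψ₀ '' (ball 0 ρ ∩ {k | (Φ ∘ Ψ₀) k ≠ 0}) := by
    rw [← h.image_eq]
    ext y
    constructor
    · rintro ⟨⟨k, hk, rfl⟩, hy⟩; exact ⟨k, ⟨hk, hy⟩, rfl⟩
    · rintro ⟨k, ⟨hk, hy⟩, rfl⟩; exact ⟨⟨k, hk, rfl⟩, hy⟩
  rw [heq]
  exact (isPreconnected_inter_ne_zero_of_convex (convex_ball _ _) isOpen_ball hcomp).image _
    (h.differentiableOn.continuousOn.mono Set.inter_subset_left)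

end GoodNhd

/-- **Good neighbourhoods of a regular point** (holomorphic implicit function theorem,
`exists_straightening`). If `x ∈ Z` is a regular point of codimension `p` of `Z`, then inside any
neighbourhood of `x` there is a good neighbourhood `N ∋ x` (`GoodNhd`): `Z ∩ N` is the
holomorphic image of a ball in the kernel of the differential of the defining map and consists of
regular points of codimension `p`. [Chirka, *Complex Analytic Sets*, §2.3, A2.2] [folklore] -/
theorem IsRegPt.exists_goodNhd [FiniteDimensional ℂ E] {Z : Set E} {p : ℕ} {x : E}
    (h : IsRegPt Z p x) (hxZ : x ∈ Z)
    {N₀ : Set E} (hN₀ : N₀ ∈ 𝓝 x) :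
    ∃ (N : Set E) (K : Submodule ℂ E) (ρ : ℝ) (Ψ₀ : K → E), x ∈ N ∧ N ⊆ N₀ ∧ Ψ₀ 0 = x ∧
      GoodNhd Z N p ρ Ψ₀ := by
  obtain ⟨U, hU, hxU, g, hg, hZU, hsurj⟩ := h
  have hgx : g x = 0 := by
    have : x ∈ U ∩ g ⁻¹' {0} := hZU ▸ ⟨hxZ, hxU⟩
    exact this.2
  -- shrink `U` into `N₀`
  obtain ⟨U₁, hU₁N, hU₁o, hxU₁⟩ := _root_.mem_nhds_iff.1 (Filter.inter_mem hN₀ (hU.mem_nhds hxU))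
  have hU₁U : U₁ ⊆ U := fun y hy => (hU₁N hy).2
  have hg₁ : DifferentiableOn ℂ g U₁ := hg.mono hU₁U
  -- straightening
  set K := LinearMap.ker ((fderiv ℂ g x : E →L[ℂ] (Fin p → ℂ)) : E →ₗ[ℂ] (Fin p → ℂ)) with hK
  obtain ⟨ψ, hbij⟩ := Literature.Analysis.Complex.SCV.exists_proj_ker_bijective (fderiv ℂ g x) hsurj
  obtain ⟨S, T, Ψ, hSo, hxS, hSU, hTo, hΨd, hΦΨ, hΨΦ, hsurjS⟩ :=
    Literature.Analysis.Complex.SCV.exists_straightening hg₁ hU₁o hxU₁ ψ hbij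
  -- a ball in `T` around `Φ x = (0, 0)`
  have hΦx : ((g x, ψ (x - x)) : (Fin p → ℂ) × K) = (0, 0) := by
    rw [hgx, sub_self, map_zero]
  have h0T : ((0, 0) : (Fin p → ℂ) × K) ∈ T := hΦx ▸ (hΦΨ x hxS).1
  obtain ⟨ρ, hρ, hρT⟩ := Metric.isOpen_iff.1 hTo _ h0T
  -- the good neighbourhood
  set N : Set E := S ∩ (fun z => ((g z, ψ (z - x)) : (Fin p → ℂ) × K)) ⁻¹' ball (0, 0) ρ with hN
  have hΦc : ContinuousOn (fun z => ((g z, ψ (z - x)) : (Fin p → ℂ) × K)) S :=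
    (hg₁.continuousOn.mono hSU).prodMk ((ψ.continuous.comp (continuous_id.sub continuous_const)).continuousOn)
  have hNo : IsOpen N := hΦc.isOpen_inter_preimage hSo isOpen_ball
  have hxN : x ∈ N := ⟨hxS, by rw [Set.mem_preimage, hΦx]; exact mem_ball_self hρ⟩
  refine ⟨N, K, ρ, fun k => Ψ (0, k), hxN, fun z hz => (hU₁N (hSU hz.1)).1, ?_, ?_⟩
  · show Ψ (0, 0) = x
    rw [← hΦx]; exact (hΦΨ x hxS).2
  refine ⟨hNo, fun y hy => ?_, hρ, ?_, ?_⟩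
  · -- regularity of the points of `Z ∩ N`
    refine ⟨S, hSo, hy.2.1, g, hg₁.mono hSU, ?_, ?_⟩
    · ext z
      constructor
      · rintro ⟨hzZ, hzS⟩
        exact ⟨hzS, (hZU.subset ⟨hzZ, hU₁U (hSU hzS)⟩).2⟩
      · rintro ⟨hzS, hgz⟩
        exact ⟨(hZU.symm.subset ⟨hU₁U (hSU hzS), hgz⟩).1, hzS⟩
    · intro c
      obtain ⟨v, hv⟩ := hsurjS y hy.2.1 (c, 0)
      exact ⟨v, congrArg Prod.fst hv⟩
  · -- holomorphy of `Ψ₀`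
    refine hΨd.comp (by fun_prop) fun k hk => hρT ?_
    rw [mem_ball, Prod.dist_eq] at *
    simpa using hk
  · -- `Ψ₀ '' ball = Z ∩ N`
    ext z
    constructor
    · rintro ⟨k, hk, rfl⟩
      have hkT : ((0 : Fin p → ℂ), k) ∈ ball ((0, 0) : (Fin p → ℂ) × K) ρ := by
        rw [mem_ball, Prod.dist_eq]; simpa using hk
      obtain ⟨hzS, hΦz⟩ := hΨΦ _ (hρT hkT)
      have hgz : g (Ψ (0, k)) = 0 := congrArg Prod.fst hΦz
      refine ⟨(hZU.symm.subset ⟨hU₁U (hSU hzS), hgz⟩).1, hzS, ?_⟩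
      rw [Set.mem_preimage, hΦz]; exact hkT
    · rintro ⟨hzZ, hzS, hzB⟩
      have hgz : g z = 0 := (hZU.subset ⟨hzZ, hU₁U (hSU hzS)⟩).2
      refine ⟨ψ (z - x), ?_, ?_⟩
      · have hle : dist (ψ (z - x)) 0 ≤ max (dist (0 : Fin p → ℂ) 0) (dist (ψ (z - x)) 0) :=
          le_max_right _ _
        rw [Set.mem_preimage, hgz, mem_ball, Prod.dist_eq] at hzB
        rw [mem_ball]
        exact lt_of_le_of_lt hle hzB
      · have := (hΦΨ z hzS).2
        rwa [hgz] at this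

/-- **Regular points have connected regular neighbourhoods**: the regular locus is locally
connected, with the traces of good neighbourhoods as basic connected neighbourhoods. [folklore] -/
theorem exists_nhds_inter_eq_of_mem_regLocus [FiniteDimensional ℂ E] {Z : Set E} {x : E}
    (hx : x ∈ regLocus Z)
    {N₀ : Set E} (hN₀ : N₀ ∈ 𝓝 x) :
    ∃ N : Set E, IsOpen N ∧ x ∈ N ∧ N ⊆ N₀ ∧ IsPreconnected (Z ∩ N) ∧ Z ∩ N ⊆ regLocus Z ∧
      regLocus Z ∩ N = Z ∩ N := by
  obtain ⟨hxZ, p, hp⟩ := hx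
  obtain ⟨N, K, ρ, Ψ₀, hxN, hNN₀, -, hG⟩ := hp.exists_goodNhd hxZ hN₀
  refine ⟨N, hG.isOpen, hxN, hNN₀, hG.isPreconnected, hG.subset_regLocus, ?_⟩
  ext y
  exact ⟨fun hy => ⟨hy.1.1, hy.2⟩, fun hy => ⟨hG.subset_regLocus hy, hy.2⟩⟩

/-- The trace of a good neighbourhood of `x` lies in the connected component of `x` in the
regular locus. [folklore] -/
theorem inter_subset_connectedComponentIn_regLocus {Z N : Set E} {x : E} (hxZ : x ∈ Z)
    (hxN : x ∈ N) (hconn : IsPreconnected (Z ∩ N)) (hreg : Z ∩ N ⊆ regLocus Z) :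
    Z ∩ N ⊆ connectedComponentIn (regLocus Z) x :=
  hconn.subset_connectedComponentIn ⟨hxZ, hxN⟩ hreg

/-- **Connected components of the regular locus are open in it.** [folklore] -/
theorem exists_nhds_regLocus_inter_subset_connectedComponentIn [FiniteDimensional ℂ E]
    {Z : Set E} {x y : E}
    (hy : y ∈ connectedComponentIn (regLocus Z) x) :
    ∃ N ∈ 𝓝 y, regLocus Z ∩ N ⊆ connectedComponentIn (regLocus Z) x := by
  have hyR : y ∈ regLocus Z := connectedComponentIn_subset _ _ hy
  obtain ⟨N, hNo, hyN, -, hconn, hreg, hRN⟩ := exists_nhds_inter_eq_of_mem_regLocus hyR Filter.univ_mem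
  refine ⟨N, hNo.mem_nhds hyN, ?_⟩
  rw [hRN, connectedComponentIn_eq hy]
  exact inter_subset_connectedComponentIn_regLocus hyR.1 hyN hconn hreg

/-- **Relatively clopen subsets of preconnected sets.** If `D ⊆ C` is nonempty, relatively open
(`C ∩ u = D` for an open `u`) and relatively closed (`C ∩ closure D ⊆ D`) in the preconnected
set `C`, then `D = C`. [folklore] -/
theorem eq_of_preconnected_of_relClopen {X : Type*} [TopologicalSpace X] {C D : Set X}
    (hC : IsPreconnected C) (hDC : D ⊆ C) (hne : D.Nonempty) {u : Set X} (hu : IsOpen u)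
    (huD : C ∩ u = D) (hcl : C ∩ closure D ⊆ D) : D = C := by
  refine hDC.antisymm fun z hz => ?_
  by_contra hzD
  have hzcl : z ∉ closure D := fun h => hzD (hcl ⟨hz, h⟩)
  have hcover : C ⊆ u ∪ (closure D)ᶜ := by
    intro w hw
    by_cases hwD : w ∈ D
    · exact Or.inl (huD.symm.subset hwD).2
    · exact Or.inr fun h => hwD (hcl ⟨hw, h⟩)
  obtain ⟨w, hwC, hwu, hwcl⟩ := hC u (closure D)ᶜ hu isClosed_closure.isOpen_compl hcover
    ⟨hne.some, hDC hne.some_mem, (huD.symm.subset hne.some_mem).2⟩ ⟨z, hz, hzcl⟩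
  exact hwcl (subset_closure (huD.subset ⟨hwC, hwu⟩))

end ModelRegular

/-! ## The closure problem: set-up, transports, easy cases -/

section ClosureSetup

variable {E : Type*} [NormedAddCommGroup E] [NormedSpace ℂ E]

/-- **Regular locus of a restriction**: for `U` open, `regLocus (Z ∩ U) = regLocus Z ∩ U`.
[folklore] -/
theorem regLocus_inter_of_isOpen {Z U : Set E} (hU : IsOpen U) : regLocus (Z ∩ U) = regLocus Z ∩ U := by
  ext x
  constructor
  · rintro ⟨⟨hxZ, hxU⟩, p, hp⟩
    exact ⟨⟨hxZ, p, hp.congr hU hxU (by rw [Set.inter_assoc, Set.inter_self])⟩, hxU⟩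
  · rintro ⟨⟨hxZ, p, hp⟩, hxU⟩
    exact ⟨⟨hxZ, hxU⟩, p, hp.congr hU hxU (by rw [Set.inter_assoc, Set.inter_self])⟩

/-- **The data of the closure problem** (Chirka §5.1 Thm. (2) in the model space): `Z` is an
analytic subset of the open set `W` (contained and relatively closed in `W`, cut out by holomorphic
equations near every point of `W`) and `S` is a subset of the regular locus of `Z` which is
relatively open and relatively closed in it (equivalently, by local connectedness of the regular
locus, a union of connected components of `regLocus Z`, cf. `RegData.connectedComponentIn_subset`
and `RegData.of_biUnion`). [folklore] -/
structure RegData (W Z S : Set E) : Prop where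
  isOpen : IsOpen W
  subset : Z ⊆ W
  rel_closed : ∀ x ∈ W, x ∈ closure Z → x ∈ Z
  zeroSetAt : ∀ x ∈ W, Literature.Analysis.Complex.SCV.IsZeroSetAt Z x
  S_subset : S ⊆ regLocus Z
  S_open : ∀ x ∈ S, ∃ N ∈ 𝓝 x, regLocus Z ∩ N ⊆ S
  S_closed : ∀ x ∈ regLocus Z, x ∈ closure S → x ∈ S

/-- `IdimLE Z d` ("`Z` has intersection dimension `≤ d` everywhere"): through every point `x` of
`Z` there is an affine complex subspace `x + ι(ℂᵐ)` of codimension `≤ d` in which `x` is an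
isolated point of `Z`. (For an analytic set this holds with `d = dim Z`, Chirka §3.4–3.5; here it is
the induction parameter.) [Chirka, *Complex Analytic Sets*, §3.5 Prop. 1] [folklore] -/
def IdimLE [FiniteDimensional ℂ E] (Z : Set E) (d : ℕ) : Prop :=
  ∀ x ∈ Z, ∃ (m : ℕ) (ι : (Fin m → ℂ) →L[ℂ] E), Function.Injective ι ∧
    Module.finrank ℂ E ≤ m + d ∧ ∀ᶠ w in 𝓝[≠] (0 : Fin m → ℂ), x + ι w ∉ Z

namespace RegData

variable {W Z S : Set E}

/-- `S ⊆ Z`. [folklore] -/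
theorem S_subset_Z (h : RegData W Z S) : S ⊆ Z := h.S_subset.trans (regLocus_subset Z)

/-- `closure S ∩ W ⊆ Z`. [folklore] -/
theorem closure_S_subset (h : RegData W Z S) {x : E} (hxW : x ∈ W) (hx : x ∈ closure S) : x ∈ Z :=
  h.rel_closed x hxW (closure_mono h.S_subset_Z hx)

/-- **`S` is a union of connected components of the regular locus.** [folklore] -/
theorem connectedComponentIn_subset [FiniteDimensional ℂ E] (h : RegData W Z S) {x : E}
    (hx : x ∈ S) : connectedComponentIn (regLocus Z) x ⊆ S := by
  classical
  set C := connectedComponentIn (regLocus Z) x with hC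
  set D := C ∩ S with hD
  -- the open set witnessing relative openness
  choose! Nx hNx hNxS using h.S_open
  set u : Set E := ⋃ y ∈ D, interior (Nx y) with hu
  have huo : IsOpen u := isOpen_biUnion fun _ _ => isOpen_interior
  have hCu : C ∩ u = D := by
    ext z
    constructor
    · rintro ⟨hzC, hzu⟩
      obtain ⟨y, hyD, hzy⟩ : ∃ y ∈ D, z ∈ interior (Nx y) := by simpa [hu] using hzu
      exact ⟨hzC, hNxS y hyD.2 ⟨_root_.connectedComponentIn_subset _ _ hzC, interior_subset hzy⟩⟩
    · rintro ⟨hzC, hzS⟩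
      refine ⟨hzC, Set.mem_biUnion (x := z) ⟨hzC, hzS⟩ ?_⟩
      exact mem_interior_iff_mem_nhds.2 (hNx z hzS)
  have hcl : C ∩ closure D ⊆ D := fun z hz =>
    ⟨hz.1, h.S_closed z (_root_.connectedComponentIn_subset _ _ hz.1)
      (closure_mono Set.inter_subset_right hz.2)⟩
  have hxC : x ∈ C := mem_connectedComponentIn (h.S_subset hx)
  have := eq_of_preconnected_of_relClopen isPreconnected_connectedComponentIn
    Set.inter_subset_left ⟨x, hxC, hx⟩ huo hCu hcl
  intro z hz
  have hz' : z ∈ connectedComponentIn (regLocus Z) x ∩ S := by rw [this]; exact hz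
  exact hz'.2

/-- **Unions of connected components of the regular locus are relatively clopen** (the converse
of `connectedComponentIn_subset`), by local connectedness of the regular locus. [folklore] -/
theorem of_biUnion [FiniteDimensional ℂ E] (hW : IsOpen W) (hZW : Z ⊆ W)
    (hcl : ∀ x ∈ W, x ∈ closure Z → x ∈ Z) (han : ∀ x ∈ W, Literature.Analysis.Complex.SCV.IsZeroSetAt Z x) (J : Set E) :
    RegData W Z (⋃ y ∈ J, connectedComponentIn (regLocus Z) y) where
  isOpen := hW
  subset := hZW
  rel_closed := hcl
  zeroSetAt := han
  S_subset := Set.iUnion₂_subset fun y _ => _root_.connectedComponentIn_subset _ _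
  S_open x hx := by
    obtain ⟨y, hyJ, hxy⟩ : ∃ y ∈ J, x ∈ connectedComponentIn (regLocus Z) y := by
      simpa only [Set.mem_iUnion, exists_prop] using hx
    obtain ⟨N, hN, hNsub⟩ := exists_nhds_regLocus_inter_subset_connectedComponentIn hxy
    exact ⟨N, hN, hNsub.trans (Set.subset_biUnion_of_mem (u := fun y =>
      connectedComponentIn (regLocus Z) y) hyJ)⟩
  S_closed x hxR hxcl := by
    obtain ⟨N, hNo, hxN, -, hconn, hreg, hRN⟩ :=
      exists_nhds_inter_eq_of_mem_regLocus hxR Filter.univ_mem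
    obtain ⟨s, hsN, hsS⟩ : (N ∩ ⋃ y ∈ J, connectedComponentIn (regLocus Z) y).Nonempty :=
      _root_.mem_closure_iff.1 hxcl N hNo hxN
    obtain ⟨y, hyJ, hsy⟩ : ∃ y ∈ J, s ∈ connectedComponentIn (regLocus Z) y := by
      simpa only [Set.mem_iUnion, exists_prop] using hsS
    have hsR : s ∈ regLocus Z := _root_.connectedComponentIn_subset _ _ hsy
    have hsub : Z ∩ N ⊆ connectedComponentIn (regLocus Z) x :=
      inter_subset_connectedComponentIn_regLocus hxR.1 hxN hconn hreg
    have hs' : s ∈ connectedComponentIn (regLocus Z) x := hsub ⟨hsR.1, hsN⟩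
    have heq : connectedComponentIn (regLocus Z) y = connectedComponentIn (regLocus Z) x :=
      (connectedComponentIn_eq hsy).trans (connectedComponentIn_eq hs').symm
    refine Set.mem_biUnion hyJ ?_
    rw [heq]
    exact mem_connectedComponentIn hxR

/-- **Restriction of the closure problem to an open subset.** [folklore] -/
theorem restrict (h : RegData W Z S) {U : Set E} (hU : IsOpen U) (hUW : U ⊆ W) :
    RegData U (Z ∩ U) (S ∩ U) where
  isOpen := hU
  subset := Set.inter_subset_right
  rel_closed x hxU hx := ⟨h.rel_closed x (hUW hxU) (closure_mono Set.inter_subset_left hx), hxU⟩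
  zeroSetAt x hxU := (h.zeroSetAt x (hUW hxU)).congr hU hxU (by rw [Set.inter_assoc, Set.inter_self])
  S_subset := by
    rw [regLocus_inter_of_isOpen hU]
    exact Set.inter_subset_inter_left _ h.S_subset
  S_open x hx := by
    obtain ⟨N, hN, hNS⟩ := h.S_open x hx.1
    refine ⟨N, hN, ?_⟩
    rw [regLocus_inter_of_isOpen hU]
    rintro z ⟨⟨hzR, hzU⟩, hzN⟩
    exact ⟨hNS ⟨hzR, hzN⟩, hzU⟩
  S_closed x hx hxcl := by
    rw [regLocus_inter_of_isOpen hU] at hx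
    exact ⟨h.S_closed x hx.1 (closure_mono Set.inter_subset_left hxcl), hx.2⟩

end RegData

/-! ### Transport along continuous linear equivalences -/

section Transport

variable {Ê : Type*} [NormedAddCommGroup Ê] [NormedSpace ℂ Ê]

/-- `IsZeroSetAt` is invariant under continuous linear equivalences. [folklore] -/
theorem _root_.Literature.Analysis.Complex.SCV.IsZeroSetAt.image_equiv (Θ : E ≃L[ℂ] Ê) {Z : Set E} {x : E} (h : Literature.Analysis.Complex.SCV.IsZeroSetAt Z x) :
    Literature.Analysis.Complex.SCV.IsZeroSetAt (Θ '' Z) (Θ x) := by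
  obtain ⟨U, hU, hxU, N, g, hg, hZU⟩ := h
  refine ⟨Θ '' U, Θ.toHomeomorph.isOpenMap U hU, Set.mem_image_of_mem Θ hxU, N, g ∘ Θ.symm,
    hg.comp Θ.symm.differentiableOn fun y hy => ?_, ?_⟩
  · obtain ⟨z, hz, rfl⟩ := hy; simpa using hz
  · rw [← Set.image_inter Θ.injective, hZU, Set.image_inter Θ.injective]
    congr 1
    ext y
    simp only [Set.mem_image, Set.mem_preimage, Set.mem_singleton_iff, Function.comp_apply]
    constructor
    · rintro ⟨z, hz, rfl⟩; simpa using hz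
    · intro hy; exact ⟨Θ.symm y, hy, by simp⟩

/-- `IsZeroSetAt` is invariant under continuous linear equivalences. [folklore] -/
theorem isZeroSetAt_image_equiv_iff (Θ : E ≃L[ℂ] Ê) {Z : Set E} {x : E} :
    Literature.Analysis.Complex.SCV.IsZeroSetAt (Θ '' Z) (Θ x) ↔ Literature.Analysis.Complex.SCV.IsZeroSetAt Z x := by
  refine ⟨fun h => ?_, fun h => h.image_equiv Θ⟩
  have := h.image_equiv Θ.symm
  simpa [Set.image_image] using this

/-- `IsRegPt` is invariant under continuous linear equivalences. [folklore] -/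
theorem IsRegPt.image_equiv (Θ : E ≃L[ℂ] Ê) {Z : Set E} {p : ℕ} {x : E} (h : IsRegPt Z p x) :
    IsRegPt (Θ '' Z) p (Θ x) := by
  obtain ⟨U, hU, hxU, g, hg, hZU, hsurj⟩ := h
  refine ⟨Θ '' U, Θ.toHomeomorph.isOpenMap U hU, Set.mem_image_of_mem Θ hxU, g ∘ Θ.symm,
    hg.comp Θ.symm.differentiableOn fun y hy => ?_, ?_, ?_⟩
  · obtain ⟨z, hz, rfl⟩ := hy; simpa using hz
  · rw [← Set.image_inter Θ.injective, hZU, Set.image_inter Θ.injective]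
    congr 1
    ext y
    simp only [Set.mem_image, Set.mem_preimage, Set.mem_singleton_iff, Function.comp_apply]
    constructor
    · rintro ⟨z, hz, rfl⟩; simpa using hz
    · intro hy; exact ⟨Θ.symm y, hy, by simp⟩
  · have hgd : HasFDerivAt g (fderiv ℂ g x) x :=
      (hg.differentiableAt (hU.mem_nhds hxU)).hasFDerivAt
    have h1 : HasFDerivAt (g ∘ Θ.symm) ((fderiv ℂ g x).comp (Θ.symm : Ê →L[ℂ] E)) (Θ x) := by
      have h2 := Θ.symm.hasFDerivAt (x := Θ x)
      rw [show g = g ∘ id from rfl]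
      have : HasFDerivAt g (fderiv ℂ g x) (Θ.symm (Θ x)) := by simpa using hgd
      exact this.comp (Θ x) h2
    rw [h1.fderiv]
    intro c
    obtain ⟨v, hv⟩ := hsurj c
    exact ⟨Θ v, by simp [hv]⟩

/-- The regular locus is transported by continuous linear equivalences. [folklore] -/
theorem regLocus_image_equiv (Θ : E ≃L[ℂ] Ê) (Z : Set E) : regLocus (Θ '' Z) = Θ '' regLocus Z := by
  ext y
  constructor
  · rintro ⟨hyZ, p, hp⟩
    obtain ⟨x, hxZ, rfl⟩ := hyZ
    refine ⟨x, ⟨hxZ, p, ?_⟩, rfl⟩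
    have := hp.image_equiv Θ.symm
    simpa [Set.image_image] using this
  · rintro ⟨x, ⟨hxZ, p, hp⟩, rfl⟩
    exact ⟨Set.mem_image_of_mem Θ hxZ, p, hp.image_equiv Θ⟩

/-- The closure problem is transported by continuous linear equivalences. [folklore] -/
theorem RegData.image_equiv (Θ : E ≃L[ℂ] Ê) {W Z S : Set E} (h : RegData W Z S) :
    RegData (Θ '' W) (Θ '' Z) (Θ '' S) where
  isOpen := Θ.toHomeomorph.isOpenMap W h.isOpen
  subset := Set.image_mono h.subset
  rel_closed y hyW hy := by
    obtain ⟨x, hxW, rfl⟩ := hyW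
    rw [← Θ.image_closure] at hy
    obtain ⟨x', hx', hxx'⟩ := hy
    have : x' = x := Θ.injective hxx'
    subst this
    exact Set.mem_image_of_mem Θ (h.rel_closed x' hxW hx')
  zeroSetAt y hyW := by
    obtain ⟨x, hxW, rfl⟩ := hyW
    exact (h.zeroSetAt x hxW).image_equiv Θ
  S_subset := by
    rw [regLocus_image_equiv]; exact Set.image_mono h.S_subset
  S_open y hy := by
    obtain ⟨x, hxS, rfl⟩ := hy
    obtain ⟨N, hN, hNS⟩ := h.S_open x hxS
    refine ⟨Θ '' N, Θ.toHomeomorph.isOpenMap.image_mem_nhds hN, ?_⟩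
    · rw [regLocus_image_equiv, ← Set.image_inter Θ.injective]
      exact Set.image_mono hNS
  S_closed y hyR hycl := by
    rw [regLocus_image_equiv] at hyR
    obtain ⟨x, hxR, rfl⟩ := hyR
    rw [← Θ.image_closure] at hycl
    obtain ⟨x', hx', hxx'⟩ := hycl
    have : x' = x := Θ.injective hxx'
    subst this
    exact Set.mem_image_of_mem Θ (h.S_closed x' hxR hx')

/-- `IdimLE` is transported by continuous linear equivalences. [folklore] -/
theorem IdimLE.image_equiv [FiniteDimensional ℂ E] [FiniteDimensional ℂ Ê] (Θ : E ≃L[ℂ] Ê)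
    {Z : Set E} {d : ℕ} (h : IdimLE Z d) : IdimLE (Θ '' Z) d := by
  rintro y ⟨x, hxZ, rfl⟩
  obtain ⟨m, ι, hι, hdim, hiso⟩ := h x hxZ
  refine ⟨m, (Θ : E →L[ℂ] Ê).comp ι, Θ.injective.comp hι, ?_, ?_⟩
  · rwa [← Θ.toLinearEquiv.finrank_eq]
  · refine hiso.mono fun w hw hmem => hw ?_
    obtain ⟨x', hx', hxx'⟩ := hmem
    have : x' = x + ι w := Θ.injective (by simpa using hxx')
    exact this ▸ hx'

end Transport

/-! ### Easy cases of the closure problem -/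

/-- **Points of isolation**: if `T ∩ O = {a}` for an open `O ∋ a`, then `T` is cut out near `a`
(by the coordinates of `y - a`). [folklore] -/
theorem isZeroSetAt_of_inter_eq_singleton [FiniteDimensional ℂ E] {T O : Set E} {a : E}
    (hO : IsOpen O) (ha : a ∈ O) (h : T ∩ O = {a}) : Literature.Analysis.Complex.SCV.IsZeroSetAt T a := by
  set n := Module.finrank ℂ E
  set κ : E ≃L[ℂ] (Fin n → ℂ) := ContinuousLinearEquiv.ofFinrankEq (by simp [n])
  refine ⟨O, hO, ha, n, fun y => κ (y - a), (κ.differentiable.comp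
    (differentiable_id.sub_const a)).differentiableOn, ?_⟩
  rw [h]
  ext y
  simp only [Set.mem_singleton_iff, Set.mem_inter_iff, Set.mem_preimage]
  rw [map_eq_zero_iff κ κ.injective, sub_eq_zero]
  exact ⟨fun hy => ⟨hy ▸ ha, hy⟩, fun hy => hy.2⟩

end ClosureSetup

section ClosureTools

variable {E : Type*} [NormedAddCommGroup E] [NormedSpace ℂ E]

/-- **Density along a component of the regular locus** (identity theorem on the connected
complex manifold `C`): if a holomorphic function (on an open set containing `Z`) is non-zero at
one point of a connected component `C` of `regLocus Z`, then `C ∩ {φ ≠ 0}` is dense in `C`.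
[Chirka, *Complex Analytic Sets*, §5.1 (proof of the Theorem)] [folklore] -/
theorem connectedComponentIn_subset_closure_ne_zero [FiniteDimensional ℂ E] {F' : Type*}
    [NormedAddCommGroup F'] [NormedSpace ℂ F'] [CompleteSpace F'] {Z O : Set E}
    (hZO : Z ⊆ O) {φ : E → F'} (hφ : DifferentiableOn ℂ φ O) {x : E}
    (hne : ∃ y ∈ connectedComponentIn (regLocus Z) x, φ y ≠ 0) :
    connectedComponentIn (regLocus Z) x ⊆
      closure (connectedComponentIn (regLocus Z) x ∩ {y | φ y ≠ 0}) := by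
  classical
  set C := connectedComponentIn (regLocus Z) x with hC
  set D := C ∩ closure (C ∩ {y | φ y ≠ 0}) with hD
  -- good neighbourhoods
  have hgood : ∀ y ∈ C, ∃ N : Set E, IsOpen N ∧ y ∈ N ∧ Z ∩ N ⊆ C ∧
      ((∃ y₁ ∈ Z ∩ N, φ y₁ ≠ 0) → Z ∩ N ⊆ closure ((Z ∩ N) ∩ {y | φ y ≠ 0})) := by
    intro y hyC
    have hyR : y ∈ regLocus Z := connectedComponentIn_subset _ _ hyC
    obtain ⟨hyZ, p, hp⟩ := hyR
    obtain ⟨N, K, ρ, Ψ₀, hyN, -, -, hG⟩ := hp.exists_goodNhd hyZ Filter.univ_mem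
    refine ⟨N, hG.isOpen, hyN, ?_, fun h1 => hG.subset_closure_ne_zero
      (Set.inter_subset_left.trans hZO) hφ h1⟩
    rw [hC, connectedComponentIn_eq hyC]
    exact inter_subset_connectedComponentIn_regLocus hyZ hyN hG.isPreconnected hG.subset_regLocus
  choose! Nx hNo hxN hNC hdense using hgood
  set u : Set E := ⋃ y ∈ D, Nx y with hu
  have huo : IsOpen u := isOpen_biUnion fun y hy => hNo y hy.1
  have hCu : C ∩ u = D := by
    ext z
    constructor
    · rintro ⟨hzC, hzu⟩
      obtain ⟨y, hyD, hzy⟩ : ∃ y ∈ D, z ∈ Nx y := by simpa [hu] using hzu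
      refine ⟨hzC, ?_⟩
      obtain ⟨y₁, hy₁N, hy₁C, hy₁φ⟩ : (Nx y ∩ (C ∩ {y | φ y ≠ 0})).Nonempty :=
        _root_.mem_closure_iff.1 hyD.2 _ (hNo y hyD.1) (hxN y hyD.1)
      have hzZN : z ∈ Z ∩ Nx y := ⟨(connectedComponentIn_subset _ _ hzC).1, hzy⟩
      have h1 := hdense y hyD.1 ⟨y₁, ⟨(connectedComponentIn_subset _ _ hy₁C).1, hy₁N⟩, hy₁φ⟩ hzZN
      exact closure_mono (Set.inter_subset_inter_left _ (hNC y hyD.1)) h1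
    · rintro ⟨hzC, hzcl⟩
      exact ⟨hzC, Set.mem_biUnion (x := z) ⟨hzC, hzcl⟩ (hxN z hzC)⟩
  have hcl : C ∩ closure D ⊆ D := fun z hz =>
    ⟨hz.1, closure_minimal Set.inter_subset_right isClosed_closure hz.2⟩
  obtain ⟨y₀, hy₀C, hy₀φ⟩ := hne
  have hD_ne : D.Nonempty := ⟨y₀, hy₀C, subset_closure ⟨hy₀C, hy₀φ⟩⟩
  have := eq_of_preconnected_of_relClopen isPreconnected_connectedComponentIn Set.inter_subset_left
    hD_ne huo hCu hcl
  intro z hz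
  have hz' : z ∈ C ∩ closure (C ∩ {y | φ y ≠ 0}) := by rw [this]; exact hz
  exact hz'.2

/-- **Balls of regular points of codimension `0`**: an open ball contained in `Z` consists of
regular points of `Z` of codimension `0`. [folklore] -/
theorem isRegPt_zero_of_ball_subset {Z : Set E} {a : E} {ρ : ℝ} (hρ : ball a ρ ⊆ Z) {y : E}
    (hy : y ∈ ball a ρ) : IsRegPt Z 0 y := by
  refine ⟨ball a ρ, isOpen_ball, hy, fun _ => 0, differentiableOn_const _, ?_, fun c =>
    ⟨0, Subsingleton.elim _ _⟩⟩
  ext z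
  simp only [Set.mem_inter_iff, Set.mem_preimage, Set.mem_singleton_iff, and_true]
  exact ⟨fun h => h.2, fun h => ⟨hρ h, h⟩⟩

/-- **Easy case: `Z` is a neighbourhood of `a`.** Then `closure S` is cut out near `a` (it is a
neighbourhood of `a` or does not accumulate at `a`). [folklore] -/
theorem RegData.isZeroSetAt_closure_of_mem_nhds [FiniteDimensional ℂ E] {W Z S : Set E}
    (h : RegData W Z S) {a : E} (ha : Z ∈ 𝓝 a) : Literature.Analysis.Complex.SCV.IsZeroSetAt (closure S) a := by
  obtain ⟨ρ, hρ, hball⟩ := Metric.mem_nhds_iff.1 ha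
  have hreg : ball a ρ ⊆ regLocus Z := fun y hy => ⟨hball hy, 0, isRegPt_zero_of_ball_subset hball hy⟩
  by_cases hS : (S ∩ ball a ρ).Nonempty
  · obtain ⟨s, hsS, hsB⟩ := hS
    have h1 : ball a ρ ⊆ connectedComponentIn (regLocus Z) s :=
      (convex_ball a ρ).isPreconnected.subset_connectedComponentIn hsB hreg
    have h2 : ball a ρ ⊆ S := h1.trans (h.connectedComponentIn_subset hsS)
    exact Literature.Analysis.Complex.SCV.IsZeroSetAt.of_mem_nhds (Filter.mem_of_superset (ball_mem_nhds a hρ)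
      (h2.trans subset_closure))
  · refine Literature.Analysis.Complex.SCV.IsZeroSetAt.of_notMem_closure fun hacl => hS ?_
    rw [closure_closure] at hacl
    obtain ⟨s, hsB, hsS⟩ := _root_.mem_closure_iff.1 hacl (ball a ρ) isOpen_ball (mem_ball_self hρ)
    exact ⟨s, hsS, hsB⟩

/-- **Easy case: isolated points.** If `a` is an isolated point of `Z` (witnessed inside `W`),
then `closure S` is cut out near `a`. [folklore] -/
theorem RegData.isZeroSetAt_closure_of_isolated [FiniteDimensional ℂ E] {W Z S : Set E}
    (h : RegData W Z S) {a : E} {O : Set E} (hO : IsOpen O) (haO : a ∈ O) (hOW : O ⊆ W)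
    (hZO : Z ∩ O ⊆ {a}) : Literature.Analysis.Complex.SCV.IsZeroSetAt (closure S) a := by
  by_cases ha : a ∈ closure S
  · refine isZeroSetAt_of_inter_eq_singleton hO haO (Set.Subset.antisymm ?_ ?_)
    · rintro z ⟨hzcl, hzO⟩
      exact hZO ⟨h.closure_S_subset (hOW hzO) hzcl, hzO⟩
    · rintro z (rfl : z = a); exact ⟨ha, haO⟩
  · exact Literature.Analysis.Complex.SCV.IsZeroSetAt.of_notMem_closure (by rwa [closure_closure])

/-- **Base of the induction: `IdimLE Z 0` means `Z` is discrete.** [folklore] -/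
theorem RegData.isZeroSetAt_closure_of_idimLE_zero [FiniteDimensional ℂ E] {W Z S : Set E}
    (h : RegData W Z S) (h0 : IdimLE Z 0) {a : E} (haW : a ∈ W) : Literature.Analysis.Complex.SCV.IsZeroSetAt (closure S) a := by
  by_cases ha : a ∈ closure S
  · have haZ : a ∈ Z := h.closure_S_subset haW ha
    obtain ⟨m, ι, hι, hdim, hiso⟩ := h0 a haZ
    -- `ι` is onto, hence an open map
    have hsurj : Function.Surjective ι := by
      have h1 : Module.finrank ℂ (LinearMap.range (ι : (Fin m → ℂ) →ₗ[ℂ] E)) = m := by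
        rw [LinearMap.finrank_range_of_inj hι, Module.finrank_fin_fun]
      have h3 : Module.finrank ℂ (LinearMap.range (ι : (Fin m → ℂ) →ₗ[ℂ] E)) ≤
          Module.finrank ℂ E := Submodule.finrank_le _
      have h2 : LinearMap.range (ι : (Fin m → ℂ) →ₗ[ℂ] E) = ⊤ :=
        Submodule.eq_top_of_finrank_eq (by omega)
      exact LinearMap.range_eq_top.1 h2
    haveI : CompleteSpace E := FiniteDimensional.complete ℂ E
    have hopen : IsOpenMap fun w : Fin m → ℂ => a + ι w :=
      (isOpenMap_add_left a).comp (ι.isOpenMap hsurj)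
    -- an open set isolating `a`
    obtain ⟨V, hV, hVo, h0V⟩ : ∃ V : Set (Fin m → ℂ), (∀ w ∈ V, w ≠ 0 → a + ι w ∉ Z) ∧ IsOpen V ∧
        (0 : Fin m → ℂ) ∈ V := by
      have := hiso
      rw [eventually_nhdsWithin_iff, _root_.eventually_nhds_iff] at this
      obtain ⟨V, hV, hVo, h0V⟩ := this
      exact ⟨V, fun w hw hne => hV w hw hne, hVo, h0V⟩
    set O : Set E := (fun w : Fin m → ℂ => a + ι w) '' V ∩ W with hOdef
    have hOo : IsOpen O := (hopen V hVo).inter h.isOpen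
    have haO : a ∈ O := ⟨⟨0, h0V, by simp⟩, haW⟩
    refine h.isZeroSetAt_closure_of_isolated hOo haO Set.inter_subset_right ?_
    rintro z ⟨hzZ, ⟨w, hwV, rfl⟩, -⟩
    have hw : w = 0 := by
      by_contra hne
      exact hV w hwV hne hzZ
    simp [hw]
  · exact Literature.Analysis.Complex.SCV.IsZeroSetAt.of_notMem_closure (by rwa [closure_closure])

end ClosureTools

section Lines

variable {E : Type*} [NormedAddCommGroup E] [NormedSpace ℂ E]

/-- **A complex line on which a holomorphic function has an isolated zero.** If `φ` is
holomorphic near `a`, `φ a = 0`, and `φ` does not vanish identically near `a`, then along some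
complex line `t ↦ a + t v` (`v ≠ 0`) the zero `t = 0` of `φ` is isolated (one-variable identity
theorem on the connected slice of a ball). [Chirka, *Complex Analytic Sets*, §2.2; §3.5 Prop. 1]
[folklore] -/
theorem exists_line_eventually_ne_zero {φ : E → ℂ} {U : Set E} (hU : IsOpen U)
    (hφ : DifferentiableOn ℂ φ U) {a : E} (ha : a ∈ U) (hne : ¬ φ =ᶠ[𝓝 a] 0) (hφa : φ a = 0) :
    ∃ v : E, v ≠ 0 ∧ ∀ᶠ t in 𝓝[≠] (0 : ℂ), φ (a + t • v) ≠ 0 := by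
  obtain ⟨δ, hδ, hball⟩ := Metric.isOpen_iff.1 hU a ha
  have hfr : ∃ᶠ y in 𝓝 a, φ y ≠ 0 := by
    simpa [Filter.EventuallyEq, Filter.not_eventually] using hne
  obtain ⟨a₁, ha₁φ, ha₁⟩ := (hfr.and_eventually (ball_mem_nhds a hδ)).exists
  set v := a₁ - a with hv_def
  have hv : v ≠ 0 := fun h => by
    have : a₁ = a := sub_eq_zero.1 h
    rw [this] at ha₁φ
    exact ha₁φ hφa
  refine ⟨v, hv, ?_⟩
  set D : Set ℂ := {t | a + t • v ∈ ball a δ} with hD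
  have hDo : IsOpen D := Literature.Analysis.Complex.SCV.isOpen_slice isOpen_ball a v
  have hDc : IsPreconnected D := (convex_preimage_line (convex_ball a δ) a v).isPreconnected
  have hψ : DifferentiableOn ℂ (fun t : ℂ => φ (a + t • v)) D :=
    Literature.Analysis.Complex.SCV.differentiableOn_slice (hφ.mono hball) a v
  have h0D : (0 : ℂ) ∈ D := by
    show a + (0 : ℂ) • v ∈ ball a δ
    rw [zero_smul, add_zero]; exact mem_ball_self hδ
  have h1D : (1 : ℂ) ∈ D := by
    show a + (1 : ℂ) • v ∈ ball a δ
    rw [one_smul, hv_def, add_sub_cancel]; exact ha₁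
  have hψa : AnalyticOnNhd ℂ (fun t : ℂ => φ (a + t • v)) D := hψ.analyticOnNhd hDo
  rcases (hψa 0 h0D).eventually_eq_zero_or_eventually_ne_zero with h | h
  · exfalso
    have := hψa.eqOn_zero_of_preconnected_of_eventuallyEq_zero hDc h0D h h1D
    simp only [one_smul, hv_def, add_sub_cancel, Pi.zero_apply] at this
    exact ha₁φ this
  · exact h

/-- **A line through a non-interior point of an analytic set meeting it in an isolated point.**
[Chirka, *Complex Analytic Sets*, §3.5 Prop. 1 (case `dim < n`)] [folklore] -/
theorem exists_line_isolated {Z : Set E} {a : E} (hZ : Literature.Analysis.Complex.SCV.IsZeroSetAt Z a) (haZ : a ∈ Z)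
    (hnot : Z ∉ 𝓝 a) : ∃ v : E, v ≠ 0 ∧ ∀ᶠ t in 𝓝[≠] (0 : ℂ), a + t • v ∉ Z := by
  obtain ⟨U, hU, haU, N, g, hg, hZU⟩ := hZ
  have hga : g a = 0 := (hZU.subset ⟨haZ, haU⟩).2
  -- some component of `g` is not identically zero near `a`
  obtain ⟨l, hl⟩ : ∃ l, ¬ (fun y => g y l) =ᶠ[𝓝 a] 0 := by
    by_contra hall
    simp only [not_exists, not_not] at hall
    apply hnot
    have h0 : ∀ᶠ y in 𝓝 a, g y = 0 :=
      (Filter.eventually_all.2 hall).mono fun y hy => funext fun l => hy l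
    filter_upwards [h0, hU.mem_nhds haU] with y hy hyU
    exact (hZU.symm.subset ⟨hyU, hy⟩).1
  obtain ⟨v, hv, hev⟩ := exists_line_eventually_ne_zero hU (differentiableOn_pi.1 hg l) haU hl
    (by simp [hga])
  refine ⟨v, hv, ?_⟩
  have hmemU : ∀ᶠ t in 𝓝[≠] (0 : ℂ), a + t • v ∈ U := by
    have hc : Continuous fun t : ℂ => a + t • v := by fun_prop
    have : ∀ᶠ t in 𝓝 (0 : ℂ), a + t • v ∈ U := hc.continuousAt.preimage_mem_nhds (by
      simpa using hU.mem_nhds haU)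
    exact this.filter_mono nhdsWithin_le_nhds
  filter_upwards [hev, hmemU] with t ht htU hmem
  exact ht (by rw [(hZU.subset ⟨hmem, htU⟩).2]; rfl)

/-- The embedding `ℂ¹ → E`, `u ↦ u 0 • v`. [folklore] -/
noncomputable def lineEmb (v : E) : (Fin 1 → ℂ) →L[ℂ] E :=
  (ContinuousLinearMap.proj (0 : Fin 1)).smulRight v

/-- Formula for `lineEmb`. [folklore] -/
@[simp] theorem lineEmb_apply (v : E) (u : Fin 1 → ℂ) : lineEmb v u = u 0 • v := rfl

/-- `lineEmb v` is injective for `v ≠ 0`. [folklore] -/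
theorem lineEmb_injective {v : E} (hv : v ≠ 0) : Function.Injective (lineEmb v) := by
  intro u u' h
  simp only [lineEmb_apply] at h
  have : u 0 = u' 0 := smul_left_injective ℂ hv h
  funext i
  rw [Subsingleton.elim i 0]; exact this

omit [NormedSpace ℂ E] in
/-- `u ↦ u 0` maps punctured neighbourhoods of `0 ∈ ℂ¹` into punctured neighbourhoods of
`0 ∈ ℂ`. [folklore] -/
theorem tendsto_apply_zero_nhdsNE :
    Tendsto (fun u : Fin 1 → ℂ => u 0) (𝓝[≠] 0) (𝓝[≠] 0) := by
  refine tendsto_nhdsWithin_of_tendsto_nhds_of_eventually_within _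
    ((continuous_apply 0).continuousAt.tendsto.mono_left nhdsWithin_le_nhds) ?_
  refine eventually_nhdsWithin_of_forall fun u hu h0 => hu ?_
  funext i; rw [Subsingleton.elim i 0]; exact h0

/-- **`IdimLE` from a line**: a line through `a` meeting `Z` in an isolated point gives the
bound `IdimLE`-style data with `m = 1`. [folklore] -/
theorem exists_lineEmb_of_isolated {Z : Set E} {a v : E} (hv : v ≠ 0)
    (h : ∀ᶠ t in 𝓝[≠] (0 : ℂ), a + t • v ∉ Z) :
    Function.Injective (lineEmb v) ∧ ∀ᶠ u in 𝓝[≠] (0 : Fin 1 → ℂ), a + lineEmb v u ∉ Z :=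
  ⟨lineEmb_injective hv, by simpa only [lineEmb_apply] using tendsto_apply_zero_nhdsNE.eventually h⟩

/-! ### Coordinates adapted to an injective linear map -/

/-- **Adapted coordinates.** For an injective linear map `ι : ℂᵐ → E` (finite-dimensional `E`)
there are a complement `K` of its range and a linear isomorphism `Θ : E ≃ K × ℂᵐ` with
`Θ (ι w) = (0, w)`. [folklore] -/
theorem exists_equiv_adapted [FiniteDimensional ℂ E] {m : ℕ} (ι : (Fin m → ℂ) →L[ℂ] E)
    (hι : Function.Injective ι) :
    ∃ (K : Submodule ℂ E) (Θ : E ≃L[ℂ] (K × (Fin m → ℂ))), ∀ w, Θ (ι w) = (0, w) := by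
  set L : Submodule ℂ E := LinearMap.range (ι : (Fin m → ℂ) →ₗ[ℂ] E) with hL
  obtain ⟨K, hLK⟩ := L.exists_isCompl
  set e₁ : (L × K) ≃ₗ[ℂ] E := Submodule.prodEquivOfIsCompl L K hLK with he₁
  set e₂ : (Fin m → ℂ) ≃ₗ[ℂ] L := LinearEquiv.ofInjective (ι : (Fin m → ℂ) →ₗ[ℂ] E) hι with he₂
  set Θₗ : E ≃ₗ[ℂ] (K × (Fin m → ℂ)) :=
    e₁.symm ≪≫ₗ (LinearEquiv.prodComm ℂ L K) ≪≫ₗ ((LinearEquiv.refl ℂ K).prodCongr e₂.symm) with hΘ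
  refine ⟨K, Θₗ.toContinuousLinearEquiv, fun w => ?_⟩
  have h1 : e₁.symm (ι w) = (e₂ w, 0) := by
    have : (ι w : E) = ((e₂ w : L) : E) := by rw [he₂, LinearEquiv.ofInjective_apply]; rfl
    rw [this, he₁, Submodule.prodEquivOfIsCompl_symm_apply_left]
  show Θₗ (ι w) = (0, w)
  simp only [hΘ, LinearEquiv.trans_apply, h1, LinearEquiv.prodComm_apply, Prod.swap_prod_mk,
    LinearEquiv.prodCongr_apply, LinearEquiv.refl_apply, LinearEquiv.symm_apply_apply]

end Lines

/-! ## The induction step over a local analytic cover (Chirka §5.1, proof of the Theorem) -/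

section Core

variable {E' : Type*} [NormedAddCommGroup E'] [NormedSpace ℂ E']
  {m N : ℕ} {f : E' × (Fin (m + 1) → ℂ) → (Fin N → ℂ)} {a' : E'} {a'' : Fin (m + 1) → ℂ}
  {ε r C : ℝ} {F : Fin (m + 1) → E' × ℂ → ℂ} {rr RR : Fin (m + 1) → ℝ}

/-- The open polydisc `ball a' ε × ball a'' r`. [folklore] -/
def polydisc (a' : E') (a'' : Fin (m + 1) → ℂ) (ε r : ℝ) : Set (E' × (Fin (m + 1) → ℂ)) :=
  ball a' ε ×ˢ ball a'' r

/-- The zero set of `f` in the open polydisc. [folklore] -/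
def coverZero (f : E' × (Fin (m + 1) → ℂ) → (Fin N → ℂ)) (a' : E') (a'' : Fin (m + 1) → ℂ)
    (ε r : ℝ) : Set (E' × (Fin (m + 1) → ℂ)) :=
  polydisc a' a'' ε r ∩ f ⁻¹' {0}

omit [NormedSpace ℂ E'] in
/-- Membership in `coverZero`. [folklore] -/
theorem mem_coverZero_iff {x : E' × (Fin (m + 1) → ℂ)} :
    x ∈ coverZero f a' a'' ε r ↔ (x.1 ∈ ball a' ε ∧ x.2 ∈ ball a'' r) ∧ f x = 0 := by
  simp [coverZero, polydisc, Set.mem_prod]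

omit [NormedSpace ℂ E'] in
/-- The polydisc is open. [folklore] -/
theorem isOpen_polydisc : IsOpen (polydisc a' a'' ε r) := isOpen_ball.prod isOpen_ball

/-- **The cover structure as a predicate on `Δ`** (the conclusion of
`CoverSetup.exists_cover_structure`). [cite: Chirka1989, §3.7 Thm.] -/
def IsCoverDisc (f : E' × (Fin (m + 1) → ℂ) → (Fin N → ℂ)) (a' : E') (a'' : Fin (m + 1) → ℂ)
    (ε r : ℝ) (rr : Fin (m + 1) → ℝ) (Δ : E' → ℂ) : Prop :=
  DifferentiableOn ℂ Δ (ball a' ε) ∧ (∀ z' ∈ ball a' ε, ¬ Δ =ᶠ[𝓝 z'] 0) ∧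
    ∀ z₀ ∈ ball a' ε, Δ z₀ ≠ 0 → ∃ δ > 0, ball z₀ δ ⊆ ball a' ε ∧
      ∃ (n : ℕ) (σ : Fin n → E' → (Fin (m + 1) → ℂ)),
        (∀ j, DifferentiableOn ℂ (σ j) (ball z₀ δ)) ∧
        (∀ z' ∈ ball z₀ δ, ∀ j j', j ≠ j' → σ j z' ≠ σ j' z') ∧
        (∀ z' ∈ ball z₀ δ, ∀ j i, σ j z' i ∈ ball (a'' i) (rr i)) ∧
        ∀ z' ∈ ball z₀ δ, ∀ w ∈ closedBall a'' r, f (z', w) = 0 ↔ ∃ j, w = σ j z'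

section CoverSetup
open Literature.Analysis.Complex.SCV (CoverSetup)
open Literature.Analysis.Complex.SCV.CoverSetup

/-- Existence of `Δ` (restatement of `exists_cover_structure`). [cite: Chirka1989, §3.7 Thm.] -/
theorem _root_.Literature.Analysis.Complex.SCV.CoverSetup.exists_isCoverDisc (hS : CoverSetup f a' a'' ε r C F rr RR) :
    ∃ Δ : E' → ℂ, IsCoverDisc f a' a'' ε r rr Δ :=
  hS.exists_cover_structure

/-- **Sheets over a good base ball** (on which `Δ ≠ 0`), describing `coverZero` exactly, with at
most `K = boxBound` sheets. [folklore] -/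
theorem _root_.Literature.Analysis.Complex.SCV.CoverSetup.exists_sheets_nhds (hS : CoverSetup f a' a'' ε r C F rr RR) {Δ : E' → ℂ}
    (hΔ : IsCoverDisc f a' a'' ε r rr Δ) {z₀ : E'} (hz₀ : z₀ ∈ ball a' ε) (hΔ0 : Δ z₀ ≠ 0) :
    ∃ δ > 0, ball z₀ δ ⊆ ball a' ε ∩ Δ ⁻¹' {0}ᶜ ∧
      ∃ (n : ℕ) (σ : Fin n → E' → (Fin (m + 1) → ℂ)), n ≤ hS.boxBound ∧
        (∀ j, DifferentiableOn ℂ (σ j) (ball z₀ δ)) ∧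
        (∀ z' ∈ ball z₀ δ, ∀ j j', j ≠ j' → σ j z' ≠ σ j' z') ∧
        (∀ z' ∈ ball z₀ δ, ∀ j, σ j z' ∈ ball a'' r) ∧
        ∀ z' ∈ ball z₀ δ, ∀ w, (z', w) ∈ coverZero f a' a'' ε r ↔ ∃ j, w = σ j z' := by
  classical
  obtain ⟨δ, hδ, hδsub, n, σ, hσd, hσne, hσbox, hσiff⟩ := hΔ.2.2 z₀ hz₀ hΔ0
  -- shrink so that `Δ ≠ 0` on the ball
  obtain ⟨δ', hδ', hδ'sub⟩ : ∃ δ' > 0, ball z₀ δ' ⊆ ball z₀ δ ∩ (ball a' ε ∩ Δ ⁻¹' {0}ᶜ) := by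
    have h1 : ball a' ε ∩ Δ ⁻¹' {0}ᶜ ∈ 𝓝 z₀ :=
      (hΔ.1.continuousOn.isOpen_inter_preimage isOpen_ball isOpen_compl_singleton).mem_nhds
        ⟨hz₀, hΔ0⟩
    exact Metric.mem_nhds_iff.1 (Filter.inter_mem (isOpen_ball.mem_nhds (mem_ball_self hδ)) h1)
  have hB : ball z₀ δ' ⊆ ball z₀ δ := fun z hz => (hδ'sub hz).1
  have hmemr : ∀ z' ∈ ball z₀ δ, ∀ j, σ j z' ∈ ball a'' r := fun z' hz' j =>
    hS.mem_ball_of_mem_box (hσbox z' hz' j)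
  refine ⟨δ', hδ', fun z hz => (hδ'sub hz).2, n, σ, ?_, fun j => (hσd j).mono hB,
    fun z' hz' => hσne z' (hB hz'), fun z' hz' j => hmemr z' (hB hz') j, fun z' hz' w => ?_⟩
  · -- `n ≤ K`: the `σ j z₀` are distinct points of the root box
    have hinj : Function.Injective fun j => σ j z₀ := fun j j' h =>
      by_contra fun hne => hσne z₀ (mem_ball_self hδ) j j' hne h
    have hmem : ∀ j, σ j z₀ ∈ Literature.Analysis.Complex.SCV.rootBox F a'' rr z₀ := fun j =>
      hS.mem_rootBox_of_zero (x := (z₀, σ j z₀))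
        (mk_mem_prod hz₀ (ball_subset_closedBall (hmemr z₀ (mem_ball_self hδ) j)))
        ((hσiff z₀ (mem_ball_self hδ) _ (ball_subset_closedBall (hmemr z₀ (mem_ball_self hδ) j))).2
          ⟨j, rfl⟩)
    calc n = (Finset.univ.image fun j => σ j z₀).card := by
          rw [Finset.card_image_of_injective _ hinj, Finset.card_univ, Fintype.card_fin]
      _ ≤ (Literature.Analysis.Complex.SCV.rootBox F a'' rr z₀).card := Finset.card_le_card (by
          intro w hw
          obtain ⟨j, -, rfl⟩ := Finset.mem_image.1 hw
          exact hmem j)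
      _ ≤ hS.boxBound := hS.card_rootBox_le hz₀
  · rw [mem_coverZero_iff]
    constructor
    · rintro ⟨⟨hz'ε, hw⟩, hf0⟩
      exact (hσiff z' (hB hz') w (ball_subset_closedBall hw)).1 hf0
    · rintro ⟨j, rfl⟩
      have hz'δ := hB hz'
      exact ⟨⟨hδsub hz'δ, hmemr z' hz'δ j⟩,
        (hσiff z' hz'δ _ (ball_subset_closedBall (hmemr z' hz'δ j))).2 ⟨j, rfl⟩⟩

/-- **Points of the cover over `{Δ ≠ 0}` are regular of codimension `m + 1`**: near such a
point the zero set is the graph of one holomorphic sheet `σ`, cut out by `w - σ (z') = 0`.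
[Chirka, *Complex Analytic Sets*, §3.7, §2.3] [folklore] -/
theorem _root_.Literature.Analysis.Complex.SCV.CoverSetup.isRegPt_of_mem_coverZero (hS : CoverSetup f a' a'' ε r C F rr RR) {Δ : E' → ℂ}
    (hΔ : IsCoverDisc f a' a'' ε r rr Δ) {x : E' × (Fin (m + 1) → ℂ)}
    (hx : x ∈ coverZero f a' a'' ε r) (hΔx : Δ x.1 ≠ 0) :
    IsRegPt (coverZero f a' a'' ε r) (m + 1) x := by
  classical
  have hx1 : x.1 ∈ ball a' ε := (mem_coverZero_iff.1 hx).1.1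
  obtain ⟨δ, hδ, hδsub, n, σ, -, hσd, hσne, -, hσiff⟩ := hS.exists_sheets_nhds hΔ hx1 hΔx
  obtain ⟨j, hj⟩ := (hσiff x.1 (mem_ball_self hδ) x.2).1 (by simpa using hx)
  -- the neighbourhood: base ball, fibre away from the other sheets
  set Nset : Set (E' × (Fin (m + 1) → ℂ)) := (ball x.1 δ ×ˢ univ) ∩
    ⋂ j' ∈ Finset.univ.erase j, {y | y.1 ∈ ball x.1 δ ∧ y.2 ≠ σ j' y.1} with hNset
  have hNo : IsOpen Nset := by
    refine (isOpen_ball.prod isOpen_univ).inter (isOpen_biInter_finset fun j' _ => ?_)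
    have hc : ContinuousOn (fun y : E' × (Fin (m + 1) → ℂ) => y.2 - σ j' y.1) (ball x.1 δ ×ˢ univ) :=
      continuousOn_snd.sub ((hσd j').continuousOn.comp continuousOn_fst fun y hy => hy.1)
    have := hc.isOpen_inter_preimage (t := {(0 : Fin (m + 1) → ℂ)}ᶜ) (isOpen_ball.prod isOpen_univ)
      isOpen_compl_singleton
    convert this using 1
    ext y
    simp only [mem_setOf_eq, mem_inter_iff, mem_prod, mem_univ, and_true, mem_preimage,
      mem_compl_iff, mem_singleton_iff, sub_eq_zero]
  have hxN : x ∈ Nset := by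
    refine ⟨mk_mem_prod (mem_ball_self hδ) (mem_univ _), mem_iInter₂.2 fun j' hj' => ⟨mem_ball_self hδ, ?_⟩⟩
    rw [hj]
    exact fun h => (Finset.mem_erase.1 hj').1 (by
      by_contra hne; exact hσne x.1 (mem_ball_self hδ) j' j hne h.symm)
  set g : E' × (Fin (m + 1) → ℂ) → (Fin (m + 1) → ℂ) := fun y => y.2 - σ j y.1 with hg
  have hgd : DifferentiableOn ℂ g Nset :=
    differentiableOn_snd.sub ((hσd j).comp differentiableOn_fst fun y hy => hy.1.1)
  refine ⟨Nset, hNo, hxN, g, hgd, ?_, ?_⟩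
  · ext y
    constructor
    · rintro ⟨hyZ, hyN⟩
      refine ⟨hyN, ?_⟩
      obtain ⟨j', hj'⟩ := (hσiff y.1 hyN.1.1 y.2).1 (by simpa using hyZ)
      have : j' = j := by
        by_contra hne
        exact ((mem_iInter₂.1 hyN.2) j' (Finset.mem_erase.2 ⟨hne, Finset.mem_univ _⟩)).2 hj'
      subst this
      show y.2 - σ j' y.1 = 0
      rw [hj', sub_self]
    · rintro ⟨hyN, hgy⟩
      have hy2 : y.2 = σ j y.1 := sub_eq_zero.1 hgy
      refine ⟨?_, hyN⟩
      have := (hσiff y.1 hyN.1.1 y.2).2 ⟨j, hy2⟩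
      simpa using this
  · -- the differential `(u, c) ↦ c - Dσ(u)` is onto
    have h1 : HasFDerivAt (fun y : E' × (Fin (m + 1) → ℂ) => σ j y.1)
        ((fderiv ℂ (σ j) x.1).comp (ContinuousLinearMap.fst ℂ E' (Fin (m + 1) → ℂ))) x :=
      ((hσd j).differentiableAt (isOpen_ball.mem_nhds (mem_ball_self hδ))).hasFDerivAt.comp x
        hasFDerivAt_fst
    have h2 : HasFDerivAt g ((ContinuousLinearMap.snd ℂ E' (Fin (m + 1) → ℂ)) -
        (fderiv ℂ (σ j) x.1).comp (ContinuousLinearMap.fst ℂ E' (Fin (m + 1) → ℂ))) x :=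
      hasFDerivAt_snd.sub h1
    rw [h2.fderiv]
    intro c
    exact ⟨(0, c), by simp⟩

/-- Points of the cover over `{Δ ≠ 0}` are regular. [folklore] -/
theorem _root_.Literature.Analysis.Complex.SCV.CoverSetup.mem_regLocus_of_mem_coverZero (hS : CoverSetup f a' a'' ε r C F rr RR) {Δ : E' → ℂ}
    (hΔ : IsCoverDisc f a' a'' ε r rr Δ) {x : E' × (Fin (m + 1) → ℂ)}
    (hx : x ∈ coverZero f a' a'' ε r) (hΔx : Δ x.1 ≠ 0) : x ∈ regLocus (coverZero f a' a'' ε r) :=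
  ⟨hx, m + 1, hS.isRegPt_of_mem_coverZero hΔ hx hΔx⟩

end CoverSetup

end Core

section CorePieces

variable {E' : Type*} [NormedAddCommGroup E'] [NormedSpace ℂ E'] [FiniteDimensional ℂ E']
  {m N : ℕ} {f : E' × (Fin (m + 1) → ℂ) → (Fin N → ℂ)} {a' : E'} {a'' : Fin (m + 1) → ℂ}
  {ε r C : ℝ} {F : Fin (m + 1) → E' × ℂ → ℂ} {rr RR : Fin (m + 1) → ℝ}

section CoverSetup
open Literature.Analysis.Complex.SCV (CoverSetup)
open Literature.Analysis.Complex.SCV.CoverSetup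

/-- **Sheets are constant along `S`**: over a good base ball, a sheet of the cover lies in the
relatively clopen set `S ⊆ regLocus` as soon as one of its points does (its graph is a connected
subset of the regular locus). [folklore] -/
theorem _root_.Literature.Analysis.Complex.SCV.CoverSetup.sheet_mem_iff (hS : CoverSetup f a' a'' ε r C F rr RR) {Δ : E' → ℂ}
    (hΔ : IsCoverDisc f a' a'' ε r rr Δ) {S : Set (E' × (Fin (m + 1) → ℂ))}
    (hR : RegData (polydisc a' a'' ε r) (coverZero f a' a'' ε r) S) {z₀ : E'} {δ : ℝ}
    (hB : ball z₀ δ ⊆ ball a' ε ∩ Δ ⁻¹' {0}ᶜ) {n : ℕ} {σ : Fin n → E' → (Fin (m + 1) → ℂ)}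
    (hσd : ∀ j, DifferentiableOn ℂ (σ j) (ball z₀ δ))
    (hσiff : ∀ z' ∈ ball z₀ δ, ∀ w, (z', w) ∈ coverZero f a' a'' ε r ↔ ∃ j, w = σ j z')
    (j : Fin n) {z₁ z₂ : E'} (hz₁ : z₁ ∈ ball z₀ δ) (hz₂ : z₂ ∈ ball z₀ δ) :
    (z₁, σ j z₁) ∈ S ↔ (z₂, σ j z₂) ∈ S := by
  -- the graph of `σ j` over the ball is a preconnected subset of the regular locus
  set Γ : Set (E' × (Fin (m + 1) → ℂ)) := (fun z => (z, σ j z)) '' ball z₀ δ with hΓ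
  have hΓc : IsPreconnected Γ := (convex_ball z₀ δ).isPreconnected.image _
    ((continuousOn_id.prodMk (hσd j).continuousOn))
  have hΓreg : Γ ⊆ regLocus (coverZero f a' a'' ε r) := by
    rintro _ ⟨z, hz, rfl⟩
    exact hS.mem_regLocus_of_mem_coverZero hΔ ((hσiff z hz _).2 ⟨j, rfl⟩) (hB hz).2
  have key : ∀ {z z' : E'}, z ∈ ball z₀ δ → z' ∈ ball z₀ δ → (z, σ j z) ∈ S → (z', σ j z') ∈ S :=
    fun {z z'} hz hz' hzS => hR.connectedComponentIn_subset hzS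
      (hΓc.subset_connectedComponentIn (Set.mem_image_of_mem _ hz) hΓreg (Set.mem_image_of_mem _ hz'))
  exact ⟨key hz₁ hz₂, key hz₂ hz₁⟩

/-- **The relatively clopen set `S` over `{Δ ≠ 0}` is a cover piece.**
[Chirka, *Complex Analytic Sets*, §5.1 (proof of the Theorem: "`S₀ᵖ` is the union of certain
components of the cover")] [folklore] -/
theorem _root_.Literature.Analysis.Complex.SCV.CoverSetup.coverPiece (hS : CoverSetup f a' a'' ε r C F rr RR) {Δ : E' → ℂ}
    (hΔ : IsCoverDisc f a' a'' ε r rr Δ) {S : Set (E' × (Fin (m + 1) → ℂ))}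
    (hR : RegData (polydisc a' a'' ε r) (coverZero f a' a'' ε r) S) :
    Literature.Analysis.Complex.SCV.CoverPiece (S ∩ {x | Δ x.1 ≠ 0}) (ball a' ε) (ball a' ε ∩ Δ ⁻¹' {0}ᶜ) hS.boxBound (‖a''‖ + r) where
  isOpen_base := isOpen_ball
  isOpen := hΔ.1.continuousOn.isOpen_inter_preimage isOpen_ball isOpen_compl_singleton
  subset := Set.inter_subset_left
  thin z hz := by
    refine ⟨Δ, ball a' ε, isOpen_ball, hz.1, Subset.rfl, hΔ.1, fun x hx => ?_, hΔ.2.1 z hz.1⟩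
    by_contra hne
    exact hx.1.2 ⟨hx.1.1, hne⟩
  fst_mem x hx := ⟨(mem_coverZero_iff.1 (hR.S_subset_Z hx.1)).1.1, hx.2⟩
  norm_le x hx := by
    have h1 : x.2 ∈ ball a'' r := (mem_coverZero_iff.1 (hR.S_subset_Z hx.1)).1.2
    calc ‖x.2‖ ≤ ‖a''‖ + ‖x.2 - a''‖ := norm_le_insert' _ _
      _ ≤ ‖a''‖ + r := by rw [← dist_eq_norm]; exact add_le_add le_rfl (mem_ball.1 h1).le
  sheets z₀ hz₀ := by
    classical
    obtain ⟨δ, hδ, hδsub, n, σ, hn, hσd, hσne, hσr, hσiff⟩ := hS.exists_sheets_nhds hΔ hz₀.1 hz₀.2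
    set J₀ := Finset.univ.filter fun j : Fin n => (z₀, σ j z₀) ∈ S with hJ₀
    set e := J₀.equivFin with he
    refine ⟨δ, hδ, hδsub, J₀.card, fun i => σ (e.symm i : Fin n), ?_, fun i => hσd _,
      fun z' hz' i i' hii' h => hii' (e.symm.injective (Subtype.ext ?_)), fun z' hz' w => ?_⟩
    · exact ((Finset.card_filter_le _ _).trans (by simp)).trans hn
    · by_contra hne
      exact hσne z' hz' _ _ hne h
    · constructor
      · rintro ⟨hwS, -⟩
        obtain ⟨j, rfl⟩ := (hσiff z' hz' w).1 (hR.S_subset_Z hwS)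
        have hj : j ∈ J₀ := Finset.mem_filter.2 ⟨Finset.mem_univ _,
          (hS.sheet_mem_iff hΔ hR hδsub hσd hσiff j hz' (mem_ball_self hδ)).1 hwS⟩
        exact ⟨e ⟨j, hj⟩, by simp [he]⟩
      · rintro ⟨i, rfl⟩
        have hj : ((e.symm i : J₀) : Fin n) ∈ J₀ := (e.symm i).2
        refine ⟨(hS.sheet_mem_iff hΔ hR hδsub hσd hσiff _ (mem_ball_self hδ) hz').1
          (Finset.mem_filter.1 hj).2, (hδsub hz').2⟩

/-- The embedding `ℂ^{m+2} → E' × ℂ^{m+1}`, `u ↦ (u 0 • v, tail u)`. [folklore] -/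
noncomputable def _root_.Literature.Analysis.Complex.SCV.CoverSetup.lineProdMap (v : E') (m : ℕ) : (Fin (m + 2) → ℂ) →L[ℂ] (E' × (Fin (m + 1) → ℂ)) :=
  ((ContinuousLinearMap.proj (0 : Fin (m + 2))).smulRight v).prod
    (ContinuousLinearMap.pi fun i : Fin (m + 1) => ContinuousLinearMap.proj (Fin.succ i))

omit [FiniteDimensional ℂ E'] in
/-- Formula for `lineProdMap`. [folklore] -/
@[simp] theorem _root_.Literature.Analysis.Complex.SCV.CoverSetup.lineProdMap_apply (v : E') (m : ℕ) (u : Fin (m + 2) → ℂ) :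
    lineProdMap v m u = (u 0 • v, Fin.tail u) := rfl

omit [FiniteDimensional ℂ E'] in
/-- `lineProdMap v m` is injective for `v ≠ 0`. [folklore] -/
theorem _root_.Literature.Analysis.Complex.SCV.CoverSetup.lineProdMap_injective {v : E'} (hv : v ≠ 0) (m : ℕ) :
    Function.Injective (lineProdMap v m) := by
  intro u u' h
  simp only [lineProdMap_apply, Prod.mk.injEq] at h
  have h0 : u 0 = u' 0 := smul_left_injective ℂ hv h.1
  rw [← Fin.cons_self_tail u, ← Fin.cons_self_tail u', h0, h.2]

/-- **The intersection dimension drops on `{Δ = 0}`** (the key to the induction): every point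
`x` of `coverZero ∩ {Δ (z') = 0}` is isolated in its intersection with the affine subspace
`x + (ℂ v × ℂ^{m+1})`, where `v` spans a complex line in the base on which `Δ` has an isolated
zero at `x.1` (the fibres of the cover being finite). [Chirka, *Complex Analytic Sets*, §3.5
Prop. 1, §5.1] [folklore] -/
theorem _root_.Literature.Analysis.Complex.SCV.CoverSetup.idimLE_inter_disc_zero (hS : CoverSetup f a' a'' ε r C F rr RR) {Δ : E' → ℂ}
    (hΔ : IsCoverDisc f a' a'' ε r rr Δ) {d : ℕ}
    (hdim : Module.finrank ℂ (E' × (Fin (m + 1) → ℂ)) ≤ (m + 1) + (d + 1)) :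
    IdimLE (coverZero f a' a'' ε r ∩ {x | Δ x.1 = 0}) d := by
  rintro x ⟨hxZ, hxΔ⟩
  have hx1 : x.1 ∈ ball a' ε := (mem_coverZero_iff.1 hxZ).1.1
  obtain ⟨v, hv, hev⟩ := exists_line_eventually_ne_zero isOpen_ball hΔ.1 hx1 (hΔ.2.1 x.1 hx1) hxΔ
  refine ⟨m + 2, lineProdMap v m, lineProdMap_injective hv m, by omega, ?_⟩
  -- the finite fibre over `x.1`
  have hA : ({w | w ∈ closedBall a'' r ∧ f (x.1, w) = 0} \ {x.2}).Finite :=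
    (hS.finite_zeros hx1).subset Set.sdiff_subset
  have h_i : ∀ᶠ u in 𝓝 (0 : Fin (m + 2) → ℂ), u 0 ≠ 0 → Δ (x.1 + u 0 • v) ≠ 0 := by
    have h1 : ∀ᶠ t in 𝓝 (0 : ℂ), t ≠ 0 → Δ (x.1 + t • v) ≠ 0 := by
      rwa [eventually_nhdsWithin_iff] at hev
    have h2 : ∀ᶠ t in 𝓝 ((0 : Fin (m + 2) → ℂ) 0), t ≠ 0 → Δ (x.1 + t • v) ≠ 0 := by
      simpa using h1
    exact (continuous_apply (0 : Fin (m + 2))).continuousAt.eventually h2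
  have h_ii : ∀ᶠ u in 𝓝 (0 : Fin (m + 2) → ℂ),
      x.2 + Fin.tail u ∉ {w | w ∈ closedBall a'' r ∧ f (x.1, w) = 0} \ {x.2} := by
    have hc : Continuous fun u : Fin (m + 2) → ℂ => x.2 + Fin.tail u := by
      unfold Fin.tail; fun_prop
    have hopen : IsOpen ({w | w ∈ closedBall a'' r ∧ f (x.1, w) = 0} \ {x.2})ᶜ :=
      hA.isClosed.isOpen_compl
    refine hc.continuousAt.eventually (hopen.mem_nhds ?_)
    have h0 : x.2 + Fin.tail (0 : Fin (m + 2) → ℂ) = x.2 := by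
      rw [show Fin.tail (0 : Fin (m + 2) → ℂ) = 0 from rfl, add_zero]
    show x.2 + Fin.tail (0 : Fin (m + 2) → ℂ) ∉ _
    rw [h0]
    exact fun h => h.2 rfl
  rw [eventually_nhdsWithin_iff]
  filter_upwards [h_i, h_ii] with u hu₁ hu₂ hu0 hmem
  obtain ⟨hmemZ, hmemΔ⟩ := hmem
  have hpt : x + lineProdMap v m u = (x.1 + u 0 • v, x.2 + Fin.tail u) := by
    rw [lineProdMap_apply]; rfl
  rw [hpt] at hmemZ hmemΔ
  have hu00 : u 0 = 0 := by
    by_contra hne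
    exact hu₁ hne hmemΔ
  rw [hu00, zero_smul, add_zero] at hmemZ
  have hw : x.2 + Fin.tail u ∈ {w | w ∈ closedBall a'' r ∧ f (x.1, w) = 0} := by
    obtain ⟨⟨-, hw⟩, hf0⟩ := mem_coverZero_iff.1 hmemZ
    exact ⟨ball_subset_closedBall hw, hf0⟩
  have htail : Fin.tail u = 0 := by
    have : x.2 + Fin.tail u = x.2 := by
      by_contra hne
      exact hu₂ ⟨hw, hne⟩
    simpa using this
  apply hu0
  rw [Set.mem_singleton_iff, ← Fin.cons_self_tail u, hu00, htail]
  funext i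
  refine Fin.cases rfl (fun j => ?_) i
  simp

end CoverSetup

end CorePieces

section CoreMain

variable {E' : Type*} [NormedAddCommGroup E'] [NormedSpace ℂ E'] [FiniteDimensional ℂ E']
  {m N : ℕ} {f : E' × (Fin (m + 1) → ℂ) → (Fin N → ℂ)} {a' : E'} {a'' : Fin (m + 1) → ℂ}
  {ε r C : ℝ} {F : Fin (m + 1) → E' × ℂ → ℂ} {rr RR : Fin (m + 1) → ℝ}

/-- **The induction step of Chirka's §5.1 Theorem over a local analytic cover.** In the set-up
`CoverSetup` (zero set `Z = coverZero` of `f` in the polydisc `U`, proper with finite fibres over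
the base ball), assume the closure theorem for all closure problems with intersection dimension
`≤ d` in `E' × ℂ^{m+1}` (`ih`) and `dim (E' × ℂ^{m+1}) ≤ (m + 1) + (d + 1)`. Then for every
relatively clopen `S ⊆ regLocus Z` the closure `cl S` is cut out near the centre `(a', a'')`.
Proof (Chirka, loc. cit.): with `Δ` from `exists_cover_structure` and `Z_G = Z ∩ {Δ ≠ 0}`,
split `S` into the union `S_I` of its components meeting `Z_G` and the rest `S_II`.
`cl S_I = cl (S ∩ Z_G)` (density along components, `connectedComponentIn_subset_closure_ne_zero`)
is analytic by the cover closure theorem (`CoverPiece.closure_inter_eq`). Every component `C`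
in `S_II` lies in `Z' = Z ∩ {Δ = 0}`, inside a component `C'` of `reg Z'`, and
`C' ∖ Z_top ⊆ C` where `Z_top = cl Z_G` (analytic by the same theorem): `C' ∖ Z_top` is
preconnected (local connectedness of complements of zero loci on good neighbourhoods,
`isPreconnected_of_subset_closure_of_forall_nhds`) and consists of regular points of `Z`; and
`C' ⊆ cl (C' ∖ Z_top)`. Hence `cl S_II = cl S'` for the union `S'` of these `C'`, analytic by
the induction hypothesis applied to `Z'`, whose intersection dimension is `≤ d`
(`idimLE_inter_disc_zero`). [cite: Chirka1989, §5.1 Thm. (2) (proof), p. 52–53] -/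
theorem _root_.Literature.Analysis.Complex.SCV.CoverSetup.isZeroSetAt_closure_core (hS : Literature.Analysis.Complex.SCV.CoverSetup f a' a'' ε r C F rr RR) {d : ℕ}
    (ih : ∀ (W Z S : Set (E' × (Fin (m + 1) → ℂ))), RegData W Z S → IdimLE Z d →
      ∀ a ∈ W, Literature.Analysis.Complex.SCV.IsZeroSetAt (closure S) a)
    (hdim : Module.finrank ℂ (E' × (Fin (m + 1) → ℂ)) ≤ (m + 1) + (d + 1))
    {S : Set (E' × (Fin (m + 1) → ℂ))}
    (hR : RegData (polydisc a' a'' ε r) (coverZero f a' a'' ε r) S) :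
    Literature.Analysis.Complex.SCV.IsZeroSetAt (closure S) (a', a'') := by
  classical
  haveI : CompleteSpace E' := FiniteDimensional.complete ℂ E'
  obtain ⟨Δ, hΔ⟩ := hS.exists_isCoverDisc
  set U := polydisc a' a'' ε r with hU
  set Zc := coverZero f a' a'' ε r with hZc
  set V : Set (E' × (Fin (m + 1) → ℂ)) := ball a' ε ×ˢ univ with hV
  have hUo : IsOpen U := isOpen_polydisc
  have haU : (a', a'') ∈ U := mk_mem_prod (mem_ball_self hS.ε_pos) (mem_ball_self hS.r_pos)
  have hZU : Zc ⊆ U := Set.inter_subset_left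
  have hVo : IsOpen V := isOpen_ball.prod isOpen_univ
  have hUV : U ⊆ V := Set.prod_mono Subset.rfl (Set.subset_univ _)
  have hΔfst : DifferentiableOn ℂ (fun y : E' × (Fin (m + 1) → ℂ) => Δ y.1) V :=
    hΔ.1.comp differentiableOn_fst fun y hy => hy.1
  set ZG := Zc ∩ {x | Δ x.1 ≠ 0} with hZG
  set Z' := Zc ∩ {x | Δ x.1 = 0} with hZ'
  -- all of `regLocus Zc` is a relatively clopen set
  have hR₀ : RegData U Zc (regLocus Zc) :=
    { isOpen := hR.isOpen, subset := hR.subset, rel_closed := hR.rel_closed,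
      zeroSetAt := hR.zeroSetAt, S_subset := Subset.rfl,
      S_open := fun x _ => ⟨univ, Filter.univ_mem, Set.inter_subset_left⟩,
      S_closed := fun x hx _ => hx }
  have hZG_eq : regLocus Zc ∩ {x | Δ x.1 ≠ 0} = ZG := by
    apply Set.Subset.antisymm (Set.inter_subset_inter_left _ (regLocus_subset _))
    exact fun x hx => ⟨hS.mem_regLocus_of_mem_coverZero hΔ hx.1 hx.2, hx.2⟩
  -- the two cover pieces and the equations of their closures
  obtain ⟨M₁, Φ₁, hΦ₁d, hΦ₁⟩ := (hS.coverPiece hΔ hR).closure_inter_eq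
  obtain ⟨M₀, Φ₀, hΦ₀d, hΦ₀⟩ := (hS.coverPiece hΔ hR₀).closure_inter_eq
  rw [hZG_eq] at hΦ₀
  -- type I: the union of the components of `S` meeting `Z_G`
  set SI : Set (E' × (Fin (m + 1) → ℂ)) :=
    ⋃ x ∈ S ∩ {x | Δ x.1 ≠ 0}, connectedComponentIn (regLocus Zc) x with hSI
  set SII := S \ SI with hSII_def
  have hSI_S : SI ⊆ S := Set.iUnion₂_subset fun x hx => hR.connectedComponentIn_subset hx.1
  have hS_eq : S = SI ∪ SII := (Set.union_sdiff_cancel hSI_S).symm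
  have hclI : closure SI = closure (S ∩ {x | Δ x.1 ≠ 0}) := by
    apply Set.Subset.antisymm
    · refine closure_minimal (fun y hy => ?_) isClosed_closure
      obtain ⟨x, hx, hyx⟩ : ∃ x ∈ S ∩ {x | Δ x.1 ≠ 0}, y ∈ connectedComponentIn (regLocus Zc) x := by
        simpa only [hSI, Set.mem_iUnion, exists_prop] using hy
      have hC := connectedComponentIn_subset_closure_ne_zero (Z := Zc) (hZU.trans hUV) hΔfst
        ⟨x, mem_connectedComponentIn (hR.S_subset hx.1), hx.2⟩
      exact closure_mono (Set.inter_subset_inter_left _ (hR.connectedComponentIn_subset hx.1))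
        (hC hyx)
    · exact closure_mono fun x hx => Set.mem_biUnion hx (mem_connectedComponentIn (hR.S_subset hx.1))
  have hI : Literature.Analysis.Complex.SCV.IsZeroSetAt (closure SI) (a', a'') := by
    rw [hclI]
    exact ⟨V, hVo, hUV haU, M₁, Φ₁, hΦ₁d, hΦ₁⟩
  -- type II: points of `SII` and their components
  have hSII : ∀ x ∈ SII, x ∈ S ∧ ∀ y ∈ connectedComponentIn (regLocus Zc) x, Δ y.1 = 0 := by
    rintro x ⟨hxS, hxSI⟩
    refine ⟨hxS, fun y hy => ?_⟩
    by_contra hΔy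
    have hyS : y ∈ S := hR.connectedComponentIn_subset hxS hy
    apply hxSI
    refine Set.mem_biUnion (x := y) ⟨hyS, hΔy⟩ ?_
    rw [← connectedComponentIn_eq hy]
    exact mem_connectedComponentIn (hR.S_subset hxS)
  have hSII_Z' : ∀ x ∈ SII, connectedComponentIn (regLocus Zc) x ⊆ Z' := fun x hx y hy =>
    ⟨regLocus_subset _ (connectedComponentIn_subset _ _ hy), (hSII x hx).2 y hy⟩
  -- the closure problem for `Z'`
  have hZ'U : Z' ⊆ U := Set.inter_subset_left.trans hZU
  have hZ'V : Z' ⊆ V := hZ'U.trans hUV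
  have hZ'cl : ∀ x ∈ U, x ∈ closure Z' → x ∈ Z' := by
    intro x hxU hxcl
    refine ⟨hR.rel_closed x hxU (closure_mono Set.inter_subset_left hxcl), ?_⟩
    by_contra hne
    have hO : IsOpen (V ∩ (fun y : E' × (Fin (m + 1) → ℂ) => Δ y.1) ⁻¹' {0}ᶜ) :=
      hΔfst.continuousOn.isOpen_inter_preimage hVo isOpen_compl_singleton
    obtain ⟨y, ⟨-, hyΔ⟩, hyZ'⟩ := _root_.mem_closure_iff.1 hxcl _ hO ⟨hUV hxU, hne⟩
    exact hyΔ hyZ'.2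
  have hZ'an : ∀ x ∈ U, Literature.Analysis.Complex.SCV.IsZeroSetAt Z' x := by
    intro x hxU
    refine (hR.zeroSetAt x hxU).inter ⟨V, hVo, hUV hxU, 1, fun y _ => Δ y.1,
      differentiableOn_pi.2 fun _ => hΔfst, ?_⟩
    ext y
    simp only [Set.mem_inter_iff, Set.mem_setOf_eq, Set.mem_preimage, Set.mem_singleton_iff]
    constructor
    · rintro ⟨hy0, hyV⟩; exact ⟨hyV, funext fun _ => hy0⟩
    · rintro ⟨hyV, hy0⟩; exact ⟨congrFun hy0 0, hyV⟩
  set S' : Set (E' × (Fin (m + 1) → ℂ)) := ⋃ x ∈ SII, connectedComponentIn (regLocus Z') x with hS'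
  have hR' : RegData U Z' S' := RegData.of_biUnion hUo hZ'U hZ'cl hZ'an SII
  have hII' : Literature.Analysis.Complex.SCV.IsZeroSetAt (closure S') (a', a'') :=
    ih U Z' S' hR' (hS.idimLE_inter_disc_zero hΔ hdim) _ haU
  -- (a) points of `SII` are regular points of `Z'`
  have h6a : ∀ x ∈ SII, x ∈ regLocus Z' := by
    intro x hx
    obtain ⟨hxZ, p, hp⟩ := hR.S_subset (hSII x hx).1
    obtain ⟨Nn, K, ρ, Ψ₀, hxN, -, -, hG⟩ := hp.exists_goodNhd hxZ Filter.univ_mem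
    have hZN : Zc ∩ Nn ⊆ connectedComponentIn (regLocus Zc) x :=
      inter_subset_connectedComponentIn_regLocus hxZ hxN hG.isPreconnected hG.subset_regLocus
    have hZ'N : Zc ∩ Nn = Z' ∩ Nn :=
      Set.Subset.antisymm (fun y hy => ⟨hSII_Z' x hx (hZN hy), hy.2⟩)
        (Set.inter_subset_inter_left _ Set.inter_subset_left)
    exact ⟨hSII_Z' x hx (mem_connectedComponentIn ⟨hxZ, p, hp⟩), p, hp.congr hG.isOpen hxN hZ'N⟩
  have hSII_S' : SII ⊆ S' := fun x hx => Set.mem_biUnion hx (mem_connectedComponentIn (h6a x hx))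
  -- (b) `Φ₀` cuts out `cl Z_G` on `V`
  have hΦ₀iff : ∀ y ∈ V, Φ₀ y = 0 ↔ y ∈ closure ZG := fun y hy => by
    constructor
    · intro h0
      have : y ∈ V ∩ Φ₀ ⁻¹' {0} := ⟨hy, h0⟩
      rw [← hΦ₀] at this
      exact this.1
    · intro hcl
      have : y ∈ closure ZG ∩ V := ⟨hcl, hy⟩
      rw [hΦ₀] at this
      exact this.2
  -- (c) the key inclusion `C' ⊆ cl C`
  have hkey : ∀ x ∈ SII,
      connectedComponentIn (regLocus Z') x ⊆ closure (connectedComponentIn (regLocus Zc) x) := by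
    intro x hx
    set Cx := connectedComponentIn (regLocus Zc) x with hCx
    set C' := connectedComponentIn (regLocus Z') x with hC'
    have hxU : x ∈ U := hZU (hR.S_subset_Z (hSII x hx).1)
    -- `x ∉ cl Z_G`, hence `Φ₀ x ≠ 0`
    have hx_ncl : x ∉ closure ZG := by
      intro hcl
      obtain ⟨hxZ, p, hp⟩ := hR.S_subset (hSII x hx).1
      obtain ⟨Nn, K, ρ, Ψ₀, hxN, -, -, hG⟩ := hp.exists_goodNhd hxZ Filter.univ_mem
      obtain ⟨y, hyN, hyZ, hyΔ⟩ := _root_.mem_closure_iff.1 hcl Nn hG.isOpen hxN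
      have hyC : y ∈ Cx :=
        inter_subset_connectedComponentIn_regLocus hxZ hxN hG.isPreconnected hG.subset_regLocus
          ⟨hyZ, hyN⟩
      exact hyΔ ((hSII x hx).2 y hyC)
    have hΦ₀x : Φ₀ x ≠ 0 := fun h0 => hx_ncl ((hΦ₀iff x (hUV hxU)).1 h0)
    -- density of `C' ∩ {Φ₀ ≠ 0}` in `C'`
    have h6e : C' ⊆ closure (C' ∩ {y | Φ₀ y ≠ 0}) :=
      connectedComponentIn_subset_closure_ne_zero hZ'V hΦ₀d
        ⟨x, mem_connectedComponentIn (h6a x hx), hΦ₀x⟩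
    have hC'U : C' ⊆ U := (connectedComponentIn_subset _ _).trans ((regLocus_subset Z').trans hZ'U)
    -- `Q = C' ∩ {Φ₀ ≠ 0}` consists of regular points of `Zc`
    have hQreg : C' ∩ {y | Φ₀ y ≠ 0} ⊆ regLocus Zc := by
      rintro y ⟨hyC', hyΦ⟩
      have hyU := hC'U hyC'
      have hy_ncl : y ∉ closure ZG := fun h => hyΦ ((hΦ₀iff y (hUV hyU)).2 h)
      obtain ⟨hyZ', p, hp⟩ := connectedComponentIn_subset _ _ hyC'
      obtain ⟨O, hOo, hyO, hO⟩ : ∃ O : Set (E' × (Fin (m + 1) → ℂ)), IsOpen O ∧ y ∈ O ∧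
          O ∩ ZG = ∅ := by
        have := hy_ncl
        rw [_root_.mem_closure_iff] at this
        push Not at this
        obtain ⟨O, hOo, hyO, hO⟩ := this
        exact ⟨O, hOo, hyO, hO⟩
      have hZO : Z' ∩ O = Zc ∩ O := by
        refine Set.Subset.antisymm (Set.inter_subset_inter_left _ Set.inter_subset_left)
          fun z hz => ⟨⟨hz.1, ?_⟩, hz.2⟩
        by_contra hΔz
        have : z ∈ O ∩ ZG := ⟨hz.2, hz.1, hΔz⟩
        rw [hO] at this
        exact this
      exact ⟨hyZ'.1, p, hp.congr hOo hyO hZO⟩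
    -- `Q` is preconnected
    have hQconn : IsPreconnected (C' ∩ {y | Φ₀ y ≠ 0}) := by
      refine isPreconnected_of_subset_closure_of_forall_nhds isPreconnected_connectedComponentIn
        Set.inter_subset_left h6e fun y hyC' => ?_
      obtain ⟨hyZ', p, hp⟩ := connectedComponentIn_subset _ _ hyC'
      obtain ⟨Nn, K, ρ, Ψ₀, hyN, -, -, hG⟩ := hp.exists_goodNhd hyZ' Filter.univ_mem
      refine ⟨Nn, hG.isOpen.mem_nhds hyN, ?_⟩
      have h1 : Z' ∩ Nn ⊆ C' := by
        rw [hC', connectedComponentIn_eq hyC']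
        exact inter_subset_connectedComponentIn_regLocus hyZ' hyN hG.isPreconnected hG.subset_regLocus
      have hNC' : Nn ∩ (C' ∩ {y | Φ₀ y ≠ 0}) = (Z' ∩ Nn) ∩ {y | Φ₀ y ≠ 0} := by
        ext z
        constructor
        · rintro ⟨hzN, hzC', hzΦ⟩
          exact ⟨⟨regLocus_subset _ (connectedComponentIn_subset _ _ hzC'), hzN⟩, hzΦ⟩
        · rintro ⟨⟨hzZ', hzN⟩, hzΦ⟩
          exact ⟨hzN, h1 ⟨hzZ', hzN⟩, hzΦ⟩
      rw [hNC']
      exact hG.isPreconnected_inter_ne_zero (Set.inter_subset_left.trans hZ'V) hΦ₀d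
    have hxQ : x ∈ C' ∩ {y | Φ₀ y ≠ 0} := ⟨mem_connectedComponentIn (h6a x hx), hΦ₀x⟩
    have hQC : C' ∩ {y | Φ₀ y ≠ 0} ⊆ Cx := hQconn.subset_connectedComponentIn hxQ hQreg
    exact h6e.trans (closure_mono hQC)
  -- (d) components of points of `SII` stay in `SII`
  have hC_SII : ∀ x ∈ SII, connectedComponentIn (regLocus Zc) x ⊆ SII := by
    intro x hx y hy
    refine ⟨hR.connectedComponentIn_subset (hSII x hx).1 hy, fun hySI => ?_⟩
    obtain ⟨x₁, hx₁, hyx₁⟩ : ∃ x₁ ∈ S ∩ {x | Δ x.1 ≠ 0},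
        y ∈ connectedComponentIn (regLocus Zc) x₁ := by
      simpa only [hSI, Set.mem_iUnion, exists_prop] using hySI
    have h1 : x₁ ∈ connectedComponentIn (regLocus Zc) x := by
      rw [connectedComponentIn_eq hy, ← connectedComponentIn_eq hyx₁]
      exact mem_connectedComponentIn (hR.S_subset hx₁.1)
    exact hx₁.2 ((hSII x hx).2 x₁ h1)
  have hclII : closure SII = closure S' := by
    apply Set.Subset.antisymm (closure_mono hSII_S')
    refine closure_minimal (fun y hy => ?_) isClosed_closure
    obtain ⟨x, hx, hyx⟩ : ∃ x ∈ SII, y ∈ connectedComponentIn (regLocus Z') x := by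
      simpa only [hS', Set.mem_iUnion, exists_prop] using hy
    exact closure_mono (hC_SII x hx) (hkey x hx hyx)
  have hII : Literature.Analysis.Complex.SCV.IsZeroSetAt (closure SII) (a', a'') := by rw [hclII]; exact hII'
  rw [hS_eq, closure_union]
  exact hI.union hII

end CoreMain

/-! ## The closure theorem in the model space -/

section ModelTheorem

/-- **The induction on the intersection dimension.** For every `d`: in every finite-dimensional
complex normed space, every closure problem `RegData W Z S` with `IdimLE Z d` has `cl S` cut out
by holomorphic equations near every point of `W`. [cite: Chirka1989, §5.1 Thm. (2), p. 52–53] -/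
theorem isZeroSetAt_closure_of_idimLE (d : ℕ) :
    ∀ {E : Type*} [NormedAddCommGroup E] [NormedSpace ℂ E] [FiniteDimensional ℂ E]
      {W Z S : Set E}, RegData W Z S → IdimLE Z d → ∀ a ∈ W, Literature.Analysis.Complex.SCV.IsZeroSetAt (closure S) a := by
  induction d with
  | zero =>
    intro E _ _ _ W Z S hR h0 a haW
    exact hR.isZeroSetAt_closure_of_idimLE_zero h0 haW
  | succ d ih =>
    intro E _ _ _ W Z S hR hd a haW
    -- easy cases
    by_cases hacl : a ∈ closure S
    swap
    · exact Literature.Analysis.Complex.SCV.IsZeroSetAt.of_notMem_closure (by rwa [closure_closure])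
    have haZ : a ∈ Z := hR.closure_S_subset haW hacl
    by_cases hnhds : Z ∈ 𝓝 a
    · exact hR.isZeroSetAt_closure_of_mem_nhds hnhds
    -- an injective `ι : ℂ^{m'+1} → E` with `a` isolated in `Z ∩ (a + range ι)`
    obtain ⟨m', ι, hι, hdim, hiso⟩ : ∃ (m' : ℕ) (ι : (Fin (m' + 1) → ℂ) →L[ℂ] E),
        Function.Injective ι ∧ Module.finrank ℂ E ≤ (m' + 1) + (d + 1) ∧
        ∀ᶠ w in 𝓝[≠] (0 : Fin (m' + 1) → ℂ), a + ι w ∉ Z := by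
      obtain ⟨m, ι, hι, hdim, hiso⟩ := hd a haZ
      cases m with
      | zero =>
        -- no direction given: use a line
        obtain ⟨v, hv, hev⟩ := exists_line_isolated (hR.zeroSetAt a haW) haZ hnhds
        obtain ⟨hinj, hiso'⟩ := exists_lineEmb_of_isolated (Z := Z) hv hev
        exact ⟨0, lineEmb v, hinj, by omega, hiso'⟩
      | succ m' => exact ⟨m', ι, hι, hdim, hiso⟩
    -- adapted coordinates
    obtain ⟨K, Θ, hΘι⟩ := exists_equiv_adapted ι hι
    have hRt := hR.image_equiv Θ
    have hdt := hd.image_equiv Θ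
    set at' : K := (Θ a).1 with hat'
    set at'' : Fin (m' + 1) → ℂ := (Θ a).2 with hat''
    have hΘa : Θ a = (at', at'') := rfl
    -- global equations of `Θ '' Z` near `Θ a`
    obtain ⟨U₀, hU₀o, haU₀, N, f, hf, hZU₀⟩ := (hR.zeroSetAt a haW).image_equiv Θ
    -- shrink `U₀` into `Θ '' W`
    obtain ⟨U₁, hU₁o, haU₁, hU₁W, hU₁U₀⟩ : ∃ U₁ : Set (K × (Fin (m' + 1) → ℂ)), IsOpen U₁ ∧
        Θ a ∈ U₁ ∧ U₁ ⊆ Θ '' W ∧ U₁ ⊆ U₀ :=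
      ⟨U₀ ∩ Θ '' W, hU₀o.inter hRt.isOpen, ⟨haU₀, Set.mem_image_of_mem Θ haW⟩,
        Set.inter_subset_right, Set.inter_subset_left⟩
    -- isolation of `at''` in the fibre of `Θ '' Z` over `at'`
    have hisoT : ∀ᶠ w in 𝓝[≠] at'', f (at', w) ≠ 0 := by
      -- `(at', w) = Θ (a + ι (w - at''))`
      have hpt : ∀ w, ((at', w) : K × (Fin (m' + 1) → ℂ)) = Θ (a + ι (w - at'')) := by
        intro w
        rw [map_add, hΘι, hΘa, Prod.mk_add_mk, add_zero, add_sub_cancel]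
      have ht : Tendsto (fun w : Fin (m' + 1) → ℂ => w - at'') (𝓝[≠] at'') (𝓝[≠] 0) := by
        refine tendsto_nhdsWithin_of_tendsto_nhds_of_eventually_within _ ?_ ?_
        · have : Tendsto (fun w : Fin (m' + 1) → ℂ => w - at'') (𝓝 at'') (𝓝 (at'' - at'')) :=
            (continuous_id.sub continuous_const).continuousAt
          rw [sub_self] at this
          exact this.mono_left nhdsWithin_le_nhds
        · exact eventually_nhdsWithin_of_forall fun w hw h0 => hw (sub_eq_zero.1 h0)
      have hmemU₀ : ∀ᶠ w in 𝓝[≠] at'', ((at', w) : K × (Fin (m' + 1) → ℂ)) ∈ U₀ := by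
        have hc : Continuous fun w : Fin (m' + 1) → ℂ => ((at', w) : K × (Fin (m' + 1) → ℂ)) := by
          fun_prop
        exact nhdsWithin_le_nhds (hc.continuousAt.preimage_mem_nhds (hU₀o.mem_nhds (hΘa ▸ haU₀)))
      filter_upwards [ht.eventually hiso, hmemU₀] with w hw hwU₀ hf0
      apply hw
      have hmem : ((at', w) : K × (Fin (m' + 1) → ℂ)) ∈ (Θ '' Z) ∩ U₀ := by
        rw [hZU₀]; exact ⟨hwU₀, hf0⟩
      obtain ⟨z, hzZ, hz⟩ := hmem.1
      rw [hpt w] at hz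
      exact Θ.injective hz ▸ hzZ
    -- the cover set-up at `Θ a`
    obtain ⟨ε, r, C, F, rr, RR, hS, hsubU₁⟩ := Literature.Analysis.Complex.SCV.exists_coverSetup hU₁o (hf.mono hU₁U₀) haU₁ hisoT
    -- restrict the transported closure problem to the polydisc
    have hpolyW : polydisc at' at'' ε r ⊆ Θ '' W := fun x hx =>
      hU₁W (hsubU₁ ⟨hx.1, ball_subset_closedBall hx.2⟩)
    have hRp := hRt.restrict isOpen_polydisc hpolyW
    have hZeq : Θ '' Z ∩ polydisc at' at'' ε r = coverZero f at' at'' ε r := by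
      have hpU₀ : polydisc at' at'' ε r ⊆ U₀ := fun x hx =>
        hU₁U₀ (hsubU₁ ⟨hx.1, ball_subset_closedBall hx.2⟩)
      ext x
      constructor
      · rintro ⟨hxZ, hxp⟩
        exact ⟨hxp, (hZU₀.subset ⟨hxZ, hpU₀ hxp⟩).2⟩
      · rintro ⟨hxp, hx0⟩
        exact ⟨(hZU₀.symm.subset ⟨hpU₀ hxp, hx0⟩).1, hxp⟩
    rw [hZeq] at hRp
    -- the core step, for the relatively clopen set `Θ '' S ∩ polydisc`
    have hdimK : Module.finrank ℂ (K × (Fin (m' + 1) → ℂ)) ≤ (m' + 1) + (d + 1) := by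
      rwa [← Θ.toLinearEquiv.finrank_eq]
    have hcore := hS.isZeroSetAt_closure_core (fun W Z S h1 h2 => ih h1 h2) hdimK hRp
    -- back to `S`: `cl (Θ '' S ∩ polydisc)` and `cl (Θ '' S)` agree near `Θ a`
    have h1 : Literature.Analysis.Complex.SCV.IsZeroSetAt (closure (Θ '' S)) (Θ a) := by
      refine hcore.congr (V := polydisc at' at'' ε r) isOpen_polydisc ?_ ?_
      · exact mk_mem_prod (mem_ball_self hS.ε_pos) (mem_ball_self hS.r_pos)
      · apply Set.Subset.antisymm
        · exact Set.inter_subset_inter_left _ (closure_mono Set.inter_subset_left)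
        · rintro x ⟨hxcl, hxp⟩
          refine ⟨?_, hxp⟩
          rw [_root_.mem_closure_iff] at hxcl ⊢
          intro O hO hxO
          obtain ⟨y, ⟨hyO, hyp⟩, hyS⟩ := hxcl (O ∩ polydisc at' at'' ε r) (hO.inter isOpen_polydisc) ⟨hxO, hxp⟩
          exact ⟨y, hyO, hyS, hyp⟩
    rw [← Θ.image_closure] at h1
    exact (isZeroSetAt_image_equiv_iff Θ).1 h1

/-- **Closures of unions of components of the regular locus are analytic (model space).** Let
`Z` be an analytic subset of an open set `W` of a finite-dimensional complex normed space
(contained and relatively closed in `W`, cut out by finitely many holomorphic equations near each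
point of `W`), and let `S ⊆ regLocus Z` be relatively open and relatively closed in the regular
locus (e.g. a union of connected components of `regLocus Z`, `RegData.of_biUnion`). Then the
closure of `S` is cut out by finitely many holomorphic equations near every point of `W`.
This is [Chirka1989, §5.1 Thm. (2)] (analyticity clause) in the model space; the intersection
dimension hypothesis of the induction is vacuous for `d = dim E`.
[cite: Chirka1989, §5.1 Thm. (2), p. 52–53] -/
theorem RegData.isZeroSetAt_closure {E : Type*} [NormedAddCommGroup E] [NormedSpace ℂ E]
    [FiniteDimensional ℂ E] {W Z S : Set E} (h : RegData W Z S) {a : E} (ha : a ∈ W) :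
    Literature.Analysis.Complex.SCV.IsZeroSetAt (closure S) a := by
  refine isZeroSetAt_closure_of_idimLE (Module.finrank ℂ E) h (fun x _ => ?_) a ha
  refine ⟨0, 0, fun u v _ => Subsingleton.elim u v, by omega, ?_⟩
  have hempty : ({(0 : Fin 0 → ℂ)}ᶜ : Set (Fin 0 → ℂ)) = ∅ := by
    ext u; simp [Subsingleton.elim u 0]
  show ∀ᶠ w in 𝓝[{(0 : Fin 0 → ℂ)}ᶜ] 0, x + (0 : (Fin 0 → ℂ) →L[ℂ] E) w ∉ Z
  rw [hempty, nhdsWithin_empty]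
  exact Filter.eventually_bot

end ModelTheorem

/-! ## Relatively clopen unions of components (topology) -/

section ComponentsTopology

variable {X : Type*} [TopologicalSpace X]

/-- **Unions of connected components are relatively open** in a set `R` which is *locally
connected at its points* in the sense that every point of `R` has arbitrarily small open
neighbourhoods `N` with `R ∩ N` preconnected. [folklore] -/
theorem exists_nhds_inter_subset_biUnion_connectedComponentIn {R : Set X}
    (hloc : ∀ y ∈ R, ∀ N₀ ∈ 𝓝 y, ∃ N : Set X, IsOpen N ∧ y ∈ N ∧ N ⊆ N₀ ∧ IsPreconnected (R ∩ N))
    (J : Set X) {x : X} (hx : x ∈ ⋃ y ∈ J, connectedComponentIn R y) :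
    ∃ N ∈ 𝓝 x, R ∩ N ⊆ ⋃ y ∈ J, connectedComponentIn R y := by
  obtain ⟨y, hyJ, hxy⟩ : ∃ y ∈ J, x ∈ connectedComponentIn R y := by
    simpa only [Set.mem_iUnion, exists_prop] using hx
  have hxR : x ∈ R := connectedComponentIn_subset _ _ hxy
  obtain ⟨N, hNo, hxN, -, hconn⟩ := hloc x hxR univ Filter.univ_mem
  refine ⟨N, hNo.mem_nhds hxN, fun z hz => Set.mem_biUnion hyJ ?_⟩
  rw [connectedComponentIn_eq hxy]
  exact hconn.subset_connectedComponentIn ⟨hxR, hxN⟩ Set.inter_subset_left hz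

/-- **Unions of connected components are relatively closed** in a set `R` locally connected at
its points. [folklore] -/
theorem mem_biUnion_connectedComponentIn_of_mem_closure {R : Set X}
    (hloc : ∀ y ∈ R, ∀ N₀ ∈ 𝓝 y, ∃ N : Set X, IsOpen N ∧ y ∈ N ∧ N ⊆ N₀ ∧ IsPreconnected (R ∩ N))
    (J : Set X) {x : X} (hxR : x ∈ R) (hxcl : x ∈ closure (⋃ y ∈ J, connectedComponentIn R y)) :
    x ∈ ⋃ y ∈ J, connectedComponentIn R y := by
  obtain ⟨N, hNo, hxN, -, hconn⟩ := hloc x hxR univ Filter.univ_mem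
  obtain ⟨s, hsN, hsS⟩ : (N ∩ ⋃ y ∈ J, connectedComponentIn R y).Nonempty :=
    _root_.mem_closure_iff.1 hxcl N hNo hxN
  obtain ⟨y, hyJ, hsy⟩ : ∃ y ∈ J, s ∈ connectedComponentIn R y := by
    simpa only [Set.mem_iUnion, exists_prop] using hsS
  have hsR : s ∈ R := connectedComponentIn_subset _ _ hsy
  have hs' : s ∈ connectedComponentIn R x :=
    hconn.subset_connectedComponentIn ⟨hxR, hxN⟩ Set.inter_subset_left ⟨hsR, hsN⟩
  refine Set.mem_biUnion hyJ ?_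
  rw [connectedComponentIn_eq hsy, ← connectedComponentIn_eq hs']
  exact mem_connectedComponentIn hxR

end ComponentsTopology

end SCV

/-! ## Transfer to complex manifolds: Chirka §5.1 Thm. (2) and its consequences -/

section Manifold

open scoped Manifold ContDiff Topology
open SCV Literature.Analysis.Complex.SCV

variable {E : Type*} [NormedAddCommGroup E] [NormedSpace ℂ E]
  {H : Type*} [TopologicalSpace H] {I : ModelWithCorners ℂ E H}
  {M : Type*} [TopologicalSpace M] [ChartedSpace H M]

/-- The chart image `φ.target ∩ φ.symm ⁻¹' T` of `T ⊆ M` in the extended chart `φ = extChartAt I x`: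
an abbreviation for the set used throughout `Literature/Geometry/Kaehler/AnalyticSetChart.lean`,
whose transport lemmas are restated below in the model-space language of this file
(`IsZeroSetAt`, `IsRegPt`, `regLocus`) through the bridges `isZeroSetAt_iff_isAnalyticSetAt`,
`isRegularPointOfCodim_iff_isRegPt`, `regularLocus_eq_regLocus`. [folklore] -/
abbrev chartImage (I : ModelWithCorners ℂ E H) (x : M) (T : Set M) : Set E :=
  (extChartAt I x).target ∩ (extChartAt I x).symm ⁻¹' T

/-- Membership in the chart image. [folklore] -/
theorem mem_chartImage_iff {x : M} {T : Set M} {e : E} :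
    e ∈ chartImage I x T ↔ e ∈ (extChartAt I x).target ∧ (extChartAt I x).symm e ∈ T :=
  Iff.rfl

section Chart

variable [IsManifold I 1 M] [I.Boundaryless]

/-- **Analyticity transfers to the chart**: `IsAnalyticSetAt.inExtChart`
(`AnalyticSetChart.lean`) read through `isZeroSetAt_iff_isAnalyticSetAt`. [folklore] -/
theorem IsAnalyticSetAt.isZeroSetAt_chartImage {Z : Set M} {x y : M}
    (hy : y ∈ (extChartAt I x).source) (h : IsAnalyticSetAt I Z y) :
    IsZeroSetAt (chartImage I x Z) (extChartAt I x y) :=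
  isZeroSetAt_iff_isAnalyticSetAt.2 (h.inExtChart hy)

omit [I.Boundaryless] in
/-- **Analyticity transfers from the chart**: `IsAnalyticSetAt.of_inExtChart`
(`AnalyticSetChart.lean`) read through `isZeroSetAt_iff_isAnalyticSetAt`. [folklore] -/
theorem isAnalyticSetAt_of_isZeroSetAt_chartImage {T : Set M} {x y : M}
    (hy : y ∈ (extChartAt I x).source) (h : IsZeroSetAt (chartImage I x T) (extChartAt I x y)) :
    IsAnalyticSetAt I T y :=
  IsAnalyticSetAt.of_inExtChart hy (isZeroSetAt_iff_isAnalyticSetAt.1 h)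

/-- **Regularity transfers to the chart**: `IsRegularPointOfCodim.inExtChart`
(`AnalyticSetChart.lean`) read through `isRegularPointOfCodim_iff_isRegPt`. [folklore] -/
theorem IsRegularPointOfCodim.isRegPt_chartImage {Z : Set M} {p : ℕ} {x y : M}
    (hy : y ∈ (extChartAt I x).source) (h : IsRegularPointOfCodim I Z p y) :
    IsRegPt (chartImage I x Z) p (extChartAt I x y) :=
  isRegularPointOfCodim_iff_isRegPt.1 (h.inExtChart hy)

omit [I.Boundaryless] in
/-- **Regularity transfers from the chart**: `IsRegularPointOfCodim.of_inExtChart`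
(`AnalyticSetChart.lean`) read through `isRegularPointOfCodim_iff_isRegPt`. [folklore] -/
theorem isRegularPointOfCodim_of_isRegPt_chartImage {Z : Set M} {p : ℕ} {x y : M}
    (hy : y ∈ (extChartAt I x).source) (h : IsRegPt (chartImage I x Z) p (extChartAt I x y)) :
    IsRegularPointOfCodim I Z p y :=
  IsRegularPointOfCodim.of_inExtChart hy (isRegularPointOfCodim_iff_isRegPt.2 h)

/-- **The regular locus in the chart**: `extChartAt_target_inter_preimage_regularLocus`
(`AnalyticSetChart.lean`) read through `regularLocus_eq_regLocus`. [folklore] -/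
theorem mem_regLocus_chartImage_iff {Z : Set M} {x : M} {e : E}
    (he : e ∈ (extChartAt I x).target) :
    e ∈ regLocus (chartImage I x Z) ↔ (extChartAt I x).symm e ∈ regularLocus I Z := by
  rw [← regularLocus_eq_regLocus,
    show chartImage I x Z = (extChartAt I x).target ∩ (extChartAt I x).symm ⁻¹' Z from rfl,
    ← extChartAt_target_inter_preimage_regularLocus Z x]
  exact ⟨fun h => h.2, fun h => ⟨he, h⟩⟩

/-- **The regular locus of an analytic set is locally connected at its points**: every regular
point has arbitrarily small open neighbourhoods `N` with `Z ∩ N` preconnected and contained in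
the regular locus (good neighbourhoods in a chart). [folklore] -/
theorem exists_nhds_preconnected_of_mem_regularLocus [FiniteDimensional ℂ E] {Z : Set M}
    {y : M} (hy : y ∈ regularLocus I Z) {N₀ : Set M} (hN₀ : N₀ ∈ 𝓝 y) :
    ∃ N : Set M, IsOpen N ∧ y ∈ N ∧ N ⊆ N₀ ∧ IsPreconnected (Z ∩ N) ∧ Z ∩ N ⊆ regularLocus I Z := by
  set c := extChartAt I y with hc
  have hys : y ∈ c.source := mem_extChartAt_source y
  have hye : c.symm (c y) = y := c.left_inv hys
  have hreg : c y ∈ regLocus (chartImage I y Z) :=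
    (mem_regLocus_chartImage_iff (c.map_source hys)).2 (by rw [hye]; exact hy)
  -- a model-space good neighbourhood inside the chart image of `N₀ ∩ c.source`
  have hN₁ : c.target ∩ c.symm ⁻¹' (N₀ ∩ c.source) ∈ 𝓝 (c y) := by
    refine Filter.inter_mem ((isOpen_extChartAt_target y).mem_nhds (c.map_source hys)) ?_
    refine (continuousAt_extChartAt_symm y).preimage_mem_nhds ?_
    rw [hye]
    exact Filter.inter_mem hN₀ ((isOpen_extChartAt_source y).mem_nhds hys)
  obtain ⟨Ne, hNeo, hyNe, hNesub, hconn, hregN, -⟩ :=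
    exists_nhds_inter_eq_of_mem_regLocus hreg hN₁
  set N : Set M := c.source ∩ c ⁻¹' Ne with hN
  have hNo : IsOpen N := isOpen_extChartAt_preimage' y hNeo
  refine ⟨N, hNo, ⟨hys, hyNe⟩, ?_, ?_, ?_⟩
  · rintro z ⟨hzs, hzNe⟩
    have := (hNesub hzNe).2
    rw [Set.mem_preimage, c.left_inv hzs] at this
    exact this.1
  · -- `Z ∩ N` is the image of `chartImage Z ∩ Ne` under `c.symm`
    have heq : Z ∩ N = c.symm '' (chartImage I y Z ∩ Ne) := by
      ext z
      constructor
      · rintro ⟨hzZ, hzs, hzNe⟩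
        refine ⟨c z, ⟨⟨c.map_source hzs, ?_⟩, hzNe⟩, c.left_inv hzs⟩
        show c.symm (c z) ∈ Z; rw [c.left_inv hzs]; exact hzZ
      · rintro ⟨e, ⟨⟨het, heZ⟩, heNe⟩, rfl⟩
        exact ⟨heZ, c.map_target het, by show c (c.symm e) ∈ Ne; rw [c.right_inv het]; exact heNe⟩
    rw [heq]
    exact hconn.image _ ((continuousOn_extChartAt_symm y).mono fun e he => he.1.1)
  · rintro z ⟨hzZ, hzs, hzNe⟩
    have hmem : c z ∈ chartImage I y Z ∩ Ne :=
      ⟨⟨c.map_source hzs, by show c.symm (c z) ∈ Z; rw [c.left_inv hzs]; exact hzZ⟩, hzNe⟩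
    have := (mem_regLocus_chartImage_iff (c.map_source hzs)).1 (hregN hmem)
    rwa [c.left_inv hzs] at this

end Chart

variable (I) (M) in
/-- **Chirka §5.1 Theorem, part (2) (analyticity clause), discharged**: for an analytic subset
`Z` of a complex manifold and any family of connected components of its regular locus, the
closure of their union is an analytic subset. Proof: in an extended chart at `x`, the chart
image of `Z` is an analytic subset of the chart target, the chart image of the union `S` is a
relatively open and relatively closed subset of its regular locus (the regular locus being
locally connected at its points), and the model-space theorem
`Literature.Geometry.Kaehler.SCV.RegData.isZeroSetAt_closure` (Chirka's induction over local analytic covers) gives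
equations for the closure. [cite: Chirka1989, §5.1 Thm. (2), p. 52–53] -/
theorem IsAnalyticSet.isAnalyticSet_closure_biUnion_connectedComponentIn_holds :
    IsAnalyticSet.isAnalyticSet_closure_biUnion_connectedComponentIn I M := by
  intro _ _ _ Z hZ J _ x
  set S : Set M := ⋃ y ∈ J, connectedComponentIn (regularLocus I Z) y with hS
  set c := extChartAt I x with hc
  have hxs : x ∈ c.source := mem_extChartAt_source x
  -- local connectedness of the regular locus, relative clopenness of `S`
  have hloc : ∀ y ∈ regularLocus I Z, ∀ N₀ ∈ 𝓝 y, ∃ N : Set M, IsOpen N ∧ y ∈ N ∧ N ⊆ N₀ ∧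
      IsPreconnected (regularLocus I Z ∩ N) := by
    intro y hy N₀ hN₀
    obtain ⟨N, hNo, hyN, hNN₀, hconn, hreg⟩ := exists_nhds_preconnected_of_mem_regularLocus hy hN₀
    refine ⟨N, hNo, hyN, hNN₀, ?_⟩
    have : regularLocus I Z ∩ N = Z ∩ N := Set.Subset.antisymm
      (Set.inter_subset_inter_left _ (regularLocus_subset Z)) fun z hz => ⟨hreg hz, hz.2⟩
    rwa [this]
  have hSo : ∀ y ∈ S, ∃ N ∈ 𝓝 y, regularLocus I Z ∩ N ⊆ S := fun y hy =>
    exists_nhds_inter_subset_biUnion_connectedComponentIn hloc J hy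
  have hSc : ∀ y ∈ regularLocus I Z, y ∈ closure S → y ∈ S := fun y hy hycl =>
    mem_biUnion_connectedComponentIn_of_mem_closure hloc J hy hycl
  have hSreg : S ⊆ regularLocus I Z := Set.iUnion₂_subset fun y _ => connectedComponentIn_subset _ _
  -- the closure problem in the chart
  have hR : RegData c.target (chartImage I x Z) (chartImage I x S) := by
    refine ⟨isOpen_extChartAt_target x, Set.inter_subset_left, fun e he hecl => ⟨he, ?_⟩,
      fun e he => ?_, fun e he => ?_, fun e he => ?_, fun e he hecl => ?_⟩
    · -- relatively closed
      have h1 := (continuousAt_extChartAt_symm'' he).continuousWithinAt.mem_closure_image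
        (s := chartImage I x Z) hecl
      have h2 : c.symm '' chartImage I x Z ⊆ Z := by rintro _ ⟨e', he', rfl⟩; exact he'.2
      exact hZ.isClosed.closure_subset (closure_mono h2 h1)
    · -- analytic
      have := (hZ (c.symm e)).isZeroSetAt_chartImage (x := x) (c.map_target he)
      rwa [c.right_inv he] at this
    · exact (mem_regLocus_chartImage_iff he.1).2 (hSreg he.2)
    · -- relatively open
      obtain ⟨NM, hNM, hNMS⟩ := hSo _ he.2
      refine ⟨c.target ∩ c.symm ⁻¹' (NM ∩ c.source), Filter.inter_mem
        ((isOpen_extChartAt_target x).mem_nhds he.1)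
        ((continuousAt_extChartAt_symm'' he.1).preimage_mem_nhds (Filter.inter_mem hNM
          ((isOpen_extChartAt_source x).mem_nhds (c.map_target he.1)))), ?_⟩
      rintro e' ⟨he'R, he't, he'N, -⟩
      exact ⟨he't, hNMS ⟨(mem_regLocus_chartImage_iff he't).1 he'R, he'N⟩⟩
    · -- relatively closed in the regular locus
      have het : e ∈ c.target := (regLocus_subset _ he).1
      have hyR : c.symm e ∈ regularLocus I Z := (mem_regLocus_chartImage_iff het).1 he
      have h1 := (continuousAt_extChartAt_symm'' het).continuousWithinAt.mem_closure_image
        (s := chartImage I x S) hecl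
      have h2 : c.symm '' chartImage I x S ⊆ S := by rintro _ ⟨e', he', rfl⟩; exact he'.2
      exact ⟨het, hSc _ hyR (closure_mono h2 h1)⟩
  have hzero := hR.isZeroSetAt_closure (c.map_source hxs)
  -- back to `M`
  refine isAnalyticSetAt_of_isZeroSetAt_chartImage hxs (hzero.congr (isOpen_extChartAt_target x)
    (c.map_source hxs) ?_)
  ext e
  constructor
  · rintro ⟨hecl, het⟩
    refine ⟨⟨het, ?_⟩, het⟩
    have h1 := (continuousAt_extChartAt_symm'' het).continuousWithinAt.mem_closure_image
      (s := chartImage I x S) hecl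
    have h2 : c.symm '' chartImage I x S ⊆ S := by rintro _ ⟨e', he', rfl⟩; exact he'.2
    exact closure_mono h2 h1
  · rintro ⟨⟨het, hecl⟩, -⟩
    refine ⟨?_, het⟩
    rw [_root_.mem_closure_iff]
    intro O hO heO
    -- pull back `O` to a neighbourhood of `c.symm e`
    have hsrc : c.symm e ∈ c.source := c.map_target het
    have hOM : c.source ∩ c ⁻¹' (O ∩ c.target) ∈ 𝓝 (c.symm e) := by
      refine (isOpen_extChartAt_preimage' x (hO.inter (isOpen_extChartAt_target x))).mem_nhds ?_
      exact ⟨hsrc, by show c (c.symm e) ∈ O ∩ c.target; rw [c.right_inv het]; exact ⟨heO, het⟩⟩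
    obtain ⟨s, hsO, hsS⟩ := _root_.mem_closure_iff_nhds.1 hecl _ hOM
    refine ⟨c s, hsO.2.1, hsO.2.2, ?_⟩
    show c.symm (c s) ∈ S
    rw [c.left_inv hsO.1]; exact hsS

variable (I) (M) in
/-- **Chirka §5.2 Theorem 1, discharged** (via §5.1 Thm. (2)): the closure of each nonempty
stratum of regular points of codimension `p` of an analytic set is an analytic set of pure
codimension `p`. [cite: Chirka1989, §5.2 Thm. 1, p. 53] -/
theorem IsAnalyticSet.hasPureCodim_closure_regularLocusOfCodim_holds :
    IsAnalyticSet.hasPureCodim_closure_regularLocusOfCodim I M := by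
  intro _ _ _ Z hZ p hp
  exact IsAnalyticSet.hasPureCodim_closure_regularLocusOfCodim_of_components I M
    (@IsAnalyticSet.isAnalyticSet_closure_biUnion_connectedComponentIn_holds _ _ _ _ _ I M _ _) hZ hp

variable (I) (M) in
/-- **Irreducible analytic sets have pure (co)dimension, discharged** (the named fact
`Literature.Geometry.Kaehler.IsIrreducibleAnalyticSet.exists_hasPureCodim` of `AnalyticSet.lean`): every irreducible
analytic subset of a complex manifold is of pure codimension `p` for some `p`. As in
[Chirka1989, §5.3, p. 54]: "by p. 5.2, irreducible analytic sets are homogeneous in dimension"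
— density of regular points (§2.3 Thm., `subset_closure_regularLocus_holds`), the decomposition
by dimension (§5.2 Thm. 1, from §5.1 Thm. (2)), and irreducibility.
[cite: Chirka1989, §5.3, p. 54] -/
theorem IsIrreducibleAnalyticSet.exists_hasPureCodim_holds :
    IsIrreducibleAnalyticSet.exists_hasPureCodim I M := by
  intro _ _ _ Z hZ
  exact IsIrreducibleAnalyticSet.exists_hasPureCodim_of_components I M
    (@IsAnalyticSet.isAnalyticSet_closure_biUnion_connectedComponentIn_holds _ _ _ _ _ I M _ _) hZ

end Manifold

end Literature.Geometry.Kaehler
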